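import Literature.Geometry.Kaehler.ComplexTorusIntegralHodgeLatticeTopMinimalClassDefect
import Literature.Geometry.Kaehler.ComplexTorusMinimalClasses
import HarnessLib

/-!
# The Hodge lattice of a GENERAL polarised abelian variety: `Hdgᵖ(X, ℤ) = ℤγ_p` (Mattuck, `dim_ℚ Bᵖ(X) = 1`, e.g. `Sp ⊆ Hg(X)`) forces
# `J_p = 1`, `γ_p^⊥ = 0`, `D_p = 1`, `I'_p = 1`, `n_p · (p!·d₁⋯d_p)·((g−p)!·d₁⋯d_{g−p}) = g!·d₁⋯d_g`, no primitive Hodge classes, and `I_p = p!·d₁⋯d_p`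

Layer `Literature/Geometry/Kaehler`, namespace `Literature.Geometry.Kaehler.ComplexTorus`; lane `lit-hodgefound`
(Track 2 foundations library), seat p09, generation 49, row g49-#6. THEOREMS ONLY (0 definitions); no named fact, net debt 0.
The OPPOSITE END to g49-#5 (`n_p = 1`, `J_p` maximal): on a general member of the moduli space of polarised abelian varieties of type `(d₁, …, d_g)` the rational
Hodge classes are the powers of the polarisation (Mattuck; Lange Thm. 7.3.1, from Prop. 7.3.3 `Sp ⊆ Hg(X)`), so over `ℤ` (g36-#1 `ComplexTorusMinimalClasses` §7/§9,
`IsPolarizationType.integralHodgeClasses_eq_zmultiples_of_finrank_eq_one`) `Hdgᵖ(X, ℤ) = ℤγ_p` with `γ_p = θ^{∧p}/(p!·d₁⋯d_p)` the minimal class. Then every invariant of the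
tower `Hdgᵖ(X, ℤ) ⊇ ℤγ_p ⊕ γ_p^⊥ ⊇ ⊕_s M_s ⊇ ⊕_s N_s` of g47/g48/g49 is explicit (`2p + q = g = j + 2`, `B = ⟨·, γ_q ∧ ·⟩_e` on `H^{2p}(X, ℤ)`, `M = Hdgᵖ(X, ℤ)`):

* §0 lattice generalities for a line that is the whole module (`index_line_sup_orthogonal_eq_one_of_forall_exists_smul`, `orthogonal_line_eq_bot_of_forall_exists_smul`,
  `index_range_eq_natAbs_of_forall_exists_smul`: `[V : Λ ⊕ Λ^⊥] = 1`, `Λ^⊥ = 0`, `[ℤ : B(γ, V)] = |B(γ, γ)|`).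
* §1 the bridge: `dim_ℚ Bᵖ(X) = 1 ⟹` every element of the sub-module `M = Hdgᵖ(X, ℤ) ⊆ H^{2p}(X, ℤ)` is a multiple of `γ_p`
  (`IsPolarizationType.exists_int_smul_minimalClass_eq_of_finrank_hodgeClasses_eq_one`); `Sp ⊆ Hg(X) ⟹ dim_ℚ Bᵖ(X) = 1` with `g` read off the type
  (`IsPolarizationType.finrank_hodgeClasses_eq_one_of_spGroup_le`, the tree's `IsRiemannForm.finrank_hodgeClasses_eq_one_of_spGroup_le`).
* §2 **`J_p = [Hdgᵖ(X, ℤ) : ℤγ_p ⊕ γ_p^⊥] = 1`, `γ_p^⊥ = 0`, `m_p = [ℤ : B(γ_p, Hdgᵖ(X, ℤ))] = |B(γ_p, γ_p)|`, `m_p·(p!·d₁⋯d_p)²·(q!·d₁⋯d_q) = g!·d₁⋯d_g` and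
  `n_p · (p!·d₁⋯d_p)·((g−p)!·d₁⋯d_{g−p}) = g!·d₁⋯d_g`** — the relative index of the `θ`-degrees of Hodge classes among all `θ`-degrees (g48-#6) is the full lattice
  binomial, `C(g, p)` for a principal polarisation (`IsPolarizationType.top_splitting_of_forall_exists_smul`, `…relIndex_range_eq_choose_of_forall_exists_smul`,
  `…top_splitting_of_finrank_hodgeClasses_eq_one`, `…top_splitting_of_spGroup_le`).
* §3 **`D_p = 1` and `I'_p = [Hdgᵖ(X, ℤ) : ⊕_s γ_s ∧ Hdg^{p−s}(X, ℤ)_prim] = 1`** (the lower minimal-class pieces vanish with `γ_p^⊥`; g49-#2's `I'_p = J_p · D_p`), and g48-#4's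
  factorisation leaves `I_p = ∏_s (s!·d₁⋯d_s)^{ρ_pr^{(p−s)}}` (`IsPolarizationType.index_comap_iSup_minimalClassPieces_eq_one_of_forall_exists_smul`,
  `…_of_finrank_hodgeClasses_eq_one`): on a general polarised abelian variety the minimal-class decomposition of the Hodge lattice is EXACT.
* §4 **no primitive integral Hodge classes in codimension `1 ≤ i ≤ g − 1` when `dim_ℚ Bⁱ(X) = 1`** (`Hdgⁱ(X, ℤ) ∩ P^{2i} = 0`, `ρ_pr^{(i)} = 0`:
  `IsPolarizationType.integralHodgeClassesIn_inf_primitiveForms_eq_bot_of_finrank_hodgeClasses_eq_one`), hence the index of Lange's integral Lefschetz decomposition (5.22)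
  on `Hdgᵖ(X, ℤ)` is exactly the content, **`I_p = p!·d₁⋯d_p`** (`IsPolarizationType.index_comap_iSup_lefschetzPieces_eq_content_of_finrank_hodgeClasses_eq_one`,
  `…_of_spGroup_le`; consistent with the tree's `[Hdgᵖ(X, ℤ) : ℤθ^{∧p}] = p!·d₁⋯d_p`, `IsPolarizationType.relIndex_zmultiples_wedgePow_integralHodgeClasses`).

* §5 (appended, g49-#8) conversely, **WHEN IS THE TOP SPLITTING EXACT? `J_p = 1 ⟺ Hdgᵖ(X, ℤ) = ℤγ_p ⊕ γ_p^⊥ ⟺ B(γ_p, γ_p) ∣ B(γ_p, x)` on `Hdgᵖ(X, ℤ)`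
  `⟺ m_p = |B(γ_p, γ_p)| ⟺ n_p · (p!·d₁⋯d_p)·((g−p)!·d₁⋯d_{g−p}) = g!·d₁⋯d_g`** (`⟺ n_p = C(g, p)` principal): generic `mem_line_sup_orthogonal_iff_dvd`,
  `index_line_sup_orthogonal_eq_one_iff`; `IsPolarizationType.index_top_splitting_eq_one_iff`, `….index_top_splitting_eq_one_iff_relIndex_range_eq_choose`.
* §6 (appended, g49-#10) **`γ_p^⊥` IS THE LATTICE OF INTEGRAL HODGE CLASSES OF `θ`-DEGREE ZERO: `y ∈ γ_p^⊥ ⟺ ⟨θ^{∧(g−p)}, y⟩_e = 0 ⟺ ⟨γ_{g−p}, y⟩_e = 0 ⟺ B(γ_p, y) = 0`**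
  (`IsPolarizationType.mem_orthogonal_minimalClass_iff_poincarePairing_wedgePow_eq_zero`), so the top splitting is `Hdgᵖ(X, ℤ) ⊇ ℤγ_p ⊕ Hdgᵖ(X, ℤ)_{deg_θ = 0}`.
## References

* [cite: Lange2023AbelianVarietiesComplex, §7.3.1 Thm. 7.3.1, Prop. 7.3.2, Prop. 7.3.3 (PDF pp. 336–337); §7.3.2 (primitive forms, (1)–(3)); §5.4.1 Thm. 5.4.2 and (5.22)–(5.23) (PDF p. 275); §2.5.3 Thm. 2.5.16, Cor. 2.5.17 (d) (PDF p. 135); §1.5.1 (PDF p. 51)]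
* [cite: BenoistDebarre2023SmoothSubvarietiesJacobians, §1 (p. 3); §3 Prop. 3.3 and proof of Thm. 3.7 (p. 7)]
* [cite: VoisinHodgeI2002, §6.2.3 Prop. 6.22, Rem. 6.27 (PDF p. 126)]
* [cite: Kitaoka1993, Ch. 5 Prop. 5.3.3 (proof)]
* [cite: Huybrechts2016K3, Ch. 14 §0.1–§0.2]
-/


noncomputable section

-- `Module ℂ` / `SMulZeroClass ℂ` synthesis on `E [⋀^Fin k]→L[ℝ] ℂ` (as in `ComplexTorusLefschetzDecomposition`)
set_option maxSynthPendingDepth 3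

open Module Function Complex
open LinearMap (BilinForm)
open Literature.LinearAlgebra.Alternating
open Literature.Analysis.Complex (IsOfTypeAt typeSubmodule mem_typeSubmodule_iff_isOfTypeAt)

namespace Literature.Geometry.Kaehler.ComplexTorus

/-! ## §0 Lattice generalities: a line that is the whole module -/

section Generic

variable {V : Type*} [AddCommGroup V]

/-- **`[V : Λ ⊕ Λ^⊥] = 1`** for the line `Λ = ℤγ = V`. [cite: Kitaoka1993, Ch. 5 Prop. 5.3.3] [cite: Huybrechts2016K3, Ch. 14 §0.2] -/
theorem index_line_sup_orthogonal_eq_one_of_forall_exists_smul (B : BilinForm ℤ V) (γ : V) (Λ : Submodule ℤ V) (hΛ : ∀ x, x ∈ Λ ↔ ∃ a : ℤ, a • γ = x)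
    (hall : ∀ x : V, ∃ a : ℤ, a • γ = x) : (Λ ⊔ B.orthogonal Λ).toAddSubgroup.index = 1 := by
  have htop : Λ ⊔ B.orthogonal Λ = ⊤ := eq_top_iff.2 fun x _ ↦ Submodule.mem_sup_left ((hΛ x).2 (hall x))
  rw [htop, Submodule.top_toAddSubgroup, AddSubgroup.index_top]

/-- **`Λ^⊥ = 0`** for the line `Λ = ℤγ = V` with `B(γ, γ) ≠ 0`. [cite: Kitaoka1993, Ch. 5 Prop. 5.3.3] [cite: Huybrechts2016K3, Ch. 14 §0.2] -/
theorem orthogonal_line_eq_bot_of_forall_exists_smul (B : BilinForm ℤ V) (γ : V) (Λ : Submodule ℤ V) (hΛ : ∀ x, x ∈ Λ ↔ ∃ a : ℤ, a • γ = x)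
    (hall : ∀ x : V, ∃ a : ℤ, a • γ = x) (h0 : B γ γ ≠ 0) : B.orthogonal Λ = ⊥ := by
  have h := line_inf_orthogonal_eq_bot B γ Λ hΛ h0
  have hle : B.orthogonal Λ ≤ Λ := fun x _ ↦ (hΛ x).2 (hall x)
  rwa [inf_eq_right.2 hle] at h

/-- **`[ℤ : B(γ, V)] = |B(γ, γ)|`** for the line `Λ = ℤγ = V`: the value group of `γ` is `B(γ, γ)·ℤ`. [cite: Kitaoka1993, Ch. 5 Prop. 5.3.3 (proof)] [cite: Huybrechts2016K3, Ch. 14 §0.1] -/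
theorem index_range_eq_natAbs_of_forall_exists_smul (B : BilinForm ℤ V) (γ : V) (hall : ∀ x : V, ∃ a : ℤ, a • γ = x) :
    (LinearMap.range (B γ)).toAddSubgroup.index = (B γ γ).natAbs := by
  obtain ⟨Λ, hΛ⟩ : ∃ Λ : Submodule ℤ V, ∀ x, x ∈ Λ ↔ ∃ a : ℤ, a • γ = x := ⟨ℤ ∙ γ, fun x ↦ Submodule.mem_span_singleton⟩
  have h := index_line_sup_orthogonal_mul_index_range_eq_natAbs B γ Λ hΛ
  rwa [index_line_sup_orthogonal_eq_one_of_forall_exists_smul B γ Λ hΛ hall, one_mul] at h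

/-- `I = J · D`, `J = 1`, `D = 1` give `I = 1`. [folklore] -/
private theorem eq_one_of_eq_mul₁₀₁ {I J D : ℕ} (h : I = J * D) (hJ : J = 1) (hD : D = 1) : I = 1 := by
  subst hJ hD; simpa using h

/-- `J · n · c = C` with `J = 1` gives `n · c = C`. [folklore] -/
private theorem mul_eq_of_one_mul_mul_eq₁₀₁ {J n c C : ℕ} (h : J * n * c = C) (hJ : J = 1) : n * c = C := by
  subst hJ; simpa using h

/-- `J · n = C` with `J = 1` gives `n = C`. [folklore] -/
private theorem eq_of_one_mul_eq₁₀₁ {J n C : ℕ} (h : J * n = C) (hJ : J = 1) : n = C := by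
  subst hJ; simpa using h

end Generic

/-! ## §1 The bridge: `dim_ℚ Bᵖ(X) = 1 ⟹ Hdgᵖ(X, ℤ) = ℤγ_p` on the sub-module model -/

section Bridge

variable {ι : Type*} [Fintype ι] [DecidableEq ι] {E : Type*} [NormedAddCommGroup E] [NormedSpace ℂ E]
  {Φ : (ι → ℝ) ≃L[ℝ] E} {j p : ℕ} {η : E [⋀^Fin 2]→L[ℝ] ℝ} {d : Fin (j + 2) → ℕ}

/-- **`dim_ℚ Bᵖ(X) = 1 ⟹` every integral Hodge class of codimension `p` is an integral multiple of the minimal class `γ_p`** (g36-#1 §7 `Hdgᵖ(X, ℤ) = ℤγ_p`, read on the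
sub-module `M = Hdgᵖ(X, ℤ) ⊆ H^{2p}(X, ℤ)` of the g45–g48 lattice files). [cite: Lange2023AbelianVarietiesComplex, §7.3.1 Thm. 7.3.1, Prop. 7.3.3 (PDF pp. 336–337); §2.5.3 Thm. 2.5.16 (PDF p. 135)] [cite: BenoistDebarre2023SmoothSubvarietiesJacobians, §3 proof of Thm. 3.7 (p. 7)] -/
theorem IsPolarizationType.exists_int_smul_minimalClass_eq_of_finrank_hodgeClasses_eq_one (hd : IsPolarizationType Φ η d) (hη : IsRiemannForm Φ η)
    (hp : p ≤ j + 2) (hB1 : finrank ℚ ↥(hodgeClasses Φ p) = 1)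
    (γM : ↥(AddSubgroup.toIntSubmodule ((integralHodgeClassesIn Φ (2 * p) p).addSubgroupOf (integralForms Φ (2 * p)))))
    (hγM : wedgePow (ofRealForm η) p = ((p.factorial * ∏ i : Fin p, d (Fin.castLE hp i) : ℕ) : ℂ) •
      (((γM : ↥(AddSubgroup.toIntSubmodule ((integralHodgeClassesIn Φ (2 * p) p).addSubgroupOf (integralForms Φ (2 * p))))) :
        ↥(integralForms Φ (2 * p))) : E [⋀^Fin (2 * p)]→L[ℝ] ℂ))
    (x : ↥(AddSubgroup.toIntSubmodule ((integralHodgeClassesIn Φ (2 * p) p).addSubgroupOf (integralForms Φ (2 * p))))) : ∃ a : ℤ, a • γM = x := by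
  have hzm := hd.integralHodgeClasses_eq_zmultiples_of_finrank_eq_one hη hp
    ((γM : ↥(AddSubgroup.toIntSubmodule ((integralHodgeClassesIn Φ (2 * p) p).addSubgroupOf (integralForms Φ (2 * p))))) : ↥(integralForms Φ (2 * p))).2 hγM hB1
  have hx : (((x : ↥(AddSubgroup.toIntSubmodule ((integralHodgeClassesIn Φ (2 * p) p).addSubgroupOf (integralForms Φ (2 * p))))) :
      ↥(integralForms Φ (2 * p))) : E [⋀^Fin (2 * p)]→L[ℝ] ℂ) ∈ integralHodgeClasses Φ p := AddSubgroup.mem_addSubgroupOf.1 x.2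
  rw [hzm, AddSubgroup.mem_zmultiples_iff] at hx
  obtain ⟨a, ha⟩ := hx
  exact ⟨a, Subtype.ext (Subtype.ext ha)⟩

omit [DecidableEq ι] in
/-- `dim_ℂ E = g` for a polarised torus of type `(d₁, …, d_g)` (`rk Λ = 2g`). [cite: Lange2023AbelianVarietiesComplex, §1.5.1 (PDF p. 51)] -/
private theorem finrank_complex_eq₁₀₁ (hd : IsPolarizationType Φ η d) : finrank ℂ E = j + 2 := by
  have hcard : Fintype.card ι = 2 * (j + 2) := hd.card_eq
  let e : Fin (2 * (j + 2)) ≃ ι := (Fintype.equivFinOfCardEq hcard).symm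
  have h1 := finrank_real_of_complex E
  have h2 := finrank_real_eq Φ e
  omega

/-- **`Sp(Λ_ℝ, E) ⊆ Hg(X) ⟹ dim_ℚ Bᵖ(X) = 1`** for `p ≤ g` (Lange Prop. 7.3.3 / Thm. 7.3.1, the tree's `IsRiemannForm.finrank_hodgeClasses_eq_one_of_spGroup_le`), with the dimension
read off the type. [cite: Lange2023AbelianVarietiesComplex, §7.3.1 Thm. 7.3.1, Prop. 7.3.2, Prop. 7.3.3 (PDF pp. 336–337)] -/
theorem IsPolarizationType.finrank_hodgeClasses_eq_one_of_spGroup_le [FiniteDimensional ℂ E] (hd : IsPolarizationType Φ η d) (hη : IsRiemannForm Φ η)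
    (hHg : spGroup Φ η ≤ hodgeGroup Φ) (hp : p ≤ j + 2) : finrank ℚ ↥(hodgeClasses Φ p) = 1 :=
  hη.finrank_hodgeClasses_eq_one_of_spGroup_le hHg (by rw [finrank_complex_eq₁₀₁ hd]; exact hp)

end Bridge

/-! ## §2 The general polarised abelian variety: `Hdgᵖ(X, ℤ) = ℤγ_p ⟹ J_p = 1`, `γ_p^⊥ = 0`, `n_p·(p!·d₁⋯d_p)·((g−p)!·d₁⋯d_{g−p}) = g!·d₁⋯d_g` -/

section General

variable {ι : Type*} [Fintype ι] [DecidableEq ι] {E : Type*} [NormedAddCommGroup E] [NormedSpace ℂ E]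
  {Φ : (ι → ℝ) ≃L[ℝ] E} {j n p q : ℕ} {η : E [⋀^Fin 2]→L[ℝ] ℝ} {d : Fin (j + 2) → ℕ}

/-- **THE TOP SPLITTING WHEN `Hdgᵖ(X, ℤ) = ℤγ_p`** (`2p + q = g`, `B = ⟨·, γ_q ∧ ·⟩_e` on `H^{2p}(X, ℤ)`, `M = Hdgᵖ(X, ℤ)`, `Λ = ℤγ_p = M`): the splitting
`M ⊇ ℤγ_p ⊕ γ_p^⊥` is `M = ℤγ_p ⊕ 0` — **`J_p = [Hdgᵖ(X, ℤ) : ℤγ_p ⊕ γ_p^⊥] = 1`, `γ_p^⊥ = 0`** — the value group of `γ_p` on `M` is `B(γ_p, γ_p)·ℤ`,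
**`m_p = [ℤ : B(γ_p, Hdgᵖ(X, ℤ))] = |B(γ_p, γ_p)|`, `m_p·(p!·d₁⋯d_p)²·(q!·d₁⋯d_q) = g!·d₁⋯d_g`**, and the relative index of the value groups (g48-#6) is the whole
lattice binomial: **`n_p · (p!·d₁⋯d_p)·((g−p)!·d₁⋯d_{g−p}) = g!·d₁⋯d_g`** (`n_p = C(g, p)` for a principal polarisation). This is the case of a GENERAL polarised
abelian variety (Mattuck: `Bᵖ(X) = ℚθ^p`; §1 and Lange Thm. 7.3.1), where Lange's decomposition (5.22) of `Hdgᵖ(X, ℤ) = ℤγ_p ⊋ ℤθ^{∧p}` has index exactly `p!·d₁⋯d_p`.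
[cite: Lange2023AbelianVarietiesComplex, §7.3.1 Thm. 7.3.1, Prop. 7.3.3 (PDF pp. 336–337); §5.4.1 Thm. 5.4.2 and (5.22)–(5.23) (PDF p. 275); §2.5.3 Thm. 2.5.16, Cor. 2.5.17 (d) (PDF p. 135)]
[cite: BenoistDebarre2023SmoothSubvarietiesJacobians, §1 (p. 3); §3 proof of Thm. 3.7 (p. 7)] [cite: Kitaoka1993, Ch. 5 Prop. 5.3.3 (proof)] [cite: Huybrechts2016K3, Ch. 14 §0.1–§0.2] -/
theorem IsPolarizationType.top_splitting_of_forall_exists_smul (hd : IsPolarizationType Φ η d) (hη : IsRiemannForm Φ η)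
    (hp : p ≤ j + 2) (hq : q ≤ j + 2) (hpq : p + q ≤ j + 2) (hkq : 2 * p + q = j + 2)
    {γq : E [⋀^Fin (2 * q)]→L[ℝ] ℂ} (hγq : wedgePow (ofRealForm η) q = ((q.factorial * ∏ i : Fin q, d (Fin.castLE hq i) : ℕ) : ℂ) • γq)
    (e : Fin n ≃ ι) (hn : 2 * p + (2 * q + 2 * p) = n) {B : BilinForm ℤ ↥(integralForms Φ (2 * p))}
    (hB : ∀ x y : ↥(integralForms Φ (2 * p)),
      ((B x y : ℤ) : ℂ) = poincarePairing Φ e hn (x : E [⋀^Fin (2 * p)]→L[ℝ] ℂ) (γq.wedge (y : E [⋀^Fin (2 * p)]→L[ℝ] ℂ)))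
    (γM : ↥(AddSubgroup.toIntSubmodule ((integralHodgeClassesIn Φ (2 * p) p).addSubgroupOf (integralForms Φ (2 * p)))))
    (hγM : wedgePow (ofRealForm η) p = ((p.factorial * ∏ i : Fin p, d (Fin.castLE hp i) : ℕ) : ℂ) •
      (((γM : ↥(AddSubgroup.toIntSubmodule ((integralHodgeClassesIn Φ (2 * p) p).addSubgroupOf (integralForms Φ (2 * p))))) : ↥(integralForms Φ (2 * p))) : E [⋀^Fin (2 * p)]→L[ℝ] ℂ))
    (Λ : Submodule ℤ ↥(AddSubgroup.toIntSubmodule ((integralHodgeClassesIn Φ (2 * p) p).addSubgroupOf (integralForms Φ (2 * p))))) (hΛ : ∀ x, x ∈ Λ ↔ ∃ a : ℤ, a • γM = x)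
    (hall : ∀ x : ↥(AddSubgroup.toIntSubmodule ((integralHodgeClassesIn Φ (2 * p) p).addSubgroupOf (integralForms Φ (2 * p)))), ∃ a : ℤ, a • γM = x) :
    (Λ ⊔ (B.restrict (AddSubgroup.toIntSubmodule ((integralHodgeClassesIn Φ (2 * p) p).addSubgroupOf (integralForms Φ (2 * p))))).orthogonal Λ).toAddSubgroup.index = 1 ∧
      (B.restrict (AddSubgroup.toIntSubmodule ((integralHodgeClassesIn Φ (2 * p) p).addSubgroupOf (integralForms Φ (2 * p))))).orthogonal Λ = ⊥ ∧
      ((LinearMap.range (B.restrict (AddSubgroup.toIntSubmodule ((integralHodgeClassesIn Φ (2 * p) p).addSubgroupOf (integralForms Φ (2 * p)))) γM)).toAddSubgroup.relIndex (LinearMap.range (B (γM : ↥(integralForms Φ (2 * p))))).toAddSubgroup) * ((p.factorial * ∏ i : Fin p, d (Fin.castLE hp i)) * ((p + q).factorial * ∏ i : Fin (p + q), d (Fin.castLE hpq i))) = (j + 2).factorial * ∏ i, d i ∧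
      (LinearMap.range (B.restrict (AddSubgroup.toIntSubmodule ((integralHodgeClassesIn Φ (2 * p) p).addSubgroupOf (integralForms Φ (2 * p)))) γM)).toAddSubgroup.index = (B (γM : ↥(integralForms Φ (2 * p))) (γM : ↥(integralForms Φ (2 * p)))).natAbs ∧
      (LinearMap.range (B.restrict (AddSubgroup.toIntSubmodule ((integralHodgeClassesIn Φ (2 * p) p).addSubgroupOf (integralForms Φ (2 * p)))) γM)).toAddSubgroup.index * ((p.factorial * ∏ i : Fin p, d (Fin.castLE hp i)) ^ 2 * (q.factorial * ∏ i : Fin q, d (Fin.castLE hq i))) = (j + 2).factorial * ∏ i, d i := by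
  have hg : p + (q + p) = j + 2 := by omega
  have h6 := hd.index_top_splitting_mul_relIndex_range_mul_content_eq hη hp hq hpq hkq hγq e hn hB γM hγM Λ hΛ
  have h5 := hd.index_top_splitting_mul_index_range_mul_content_eq hη hp hq hg hγq e hn hB γM hγM Λ hΛ
  have h0 := (hd.natAbs_apply_minimalClass_self_mul_content_eq hη hp hq hg hγM hγq e hn hB (γM : ↥(integralForms Φ (2 * p))) rfl).2
  have hJ := index_line_sup_orthogonal_eq_one_of_forall_exists_smul (B.restrict (AddSubgroup.toIntSubmodule ((integralHodgeClassesIn Φ (2 * p) p).addSubgroupOf (integralForms Φ (2 * p))))) γM Λ hΛ hall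
  exact ⟨hJ, orthogonal_line_eq_bot_of_forall_exists_smul (B.restrict (AddSubgroup.toIntSubmodule ((integralHodgeClassesIn Φ (2 * p) p).addSubgroupOf (integralForms Φ (2 * p))))) γM Λ hΛ hall h0, mul_eq_of_one_mul_mul_eq₁₀₁ h6.1 hJ,
    eq_of_one_mul_eq₁₀₁ h5.2.1 hJ, mul_eq_of_one_mul_mul_eq₁₀₁ h5.1 hJ⟩

/-- **Principal polarisation, `Hdgᵖ(X, ℤ) = ℤγ_p` (`γ_p = θ^{∧p}/p!`): `n_p = [B(γ_p, H^{2p}(X, ℤ)) : B(γ_p, Hdgᵖ(X, ℤ))] = C(g, p)`** and `J_p = 1`.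
[cite: Lange2023AbelianVarietiesComplex, §7.3.1 Thm. 7.3.1 (PDF p. 336); §5.4.1 (5.22)–(5.23) (PDF p. 275); §2.5.3 Cor. 2.5.17 (d) (PDF p. 135)] [cite: BenoistDebarre2023SmoothSubvarietiesJacobians, §1 (p. 3)] -/
theorem IsPolarizationType.relIndex_range_eq_choose_of_forall_exists_smul (hd : IsPolarizationType Φ η d) (hη : IsRiemannForm Φ η)
    (h1 : ∀ i, d i = 1) (hp : p ≤ j + 2) (hq : q ≤ j + 2) (hpq : p + q ≤ j + 2) (hkq : 2 * p + q = j + 2)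
    {γq : E [⋀^Fin (2 * q)]→L[ℝ] ℂ} (hγq : wedgePow (ofRealForm η) q = ((q.factorial * ∏ i : Fin q, d (Fin.castLE hq i) : ℕ) : ℂ) • γq)
    (e : Fin n ≃ ι) (hn : 2 * p + (2 * q + 2 * p) = n) {B : BilinForm ℤ ↥(integralForms Φ (2 * p))}
    (hB : ∀ x y : ↥(integralForms Φ (2 * p)),
      ((B x y : ℤ) : ℂ) = poincarePairing Φ e hn (x : E [⋀^Fin (2 * p)]→L[ℝ] ℂ) (γq.wedge (y : E [⋀^Fin (2 * p)]→L[ℝ] ℂ)))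
    (γM : ↥(AddSubgroup.toIntSubmodule ((integralHodgeClassesIn Φ (2 * p) p).addSubgroupOf (integralForms Φ (2 * p)))))
    (hγM : wedgePow (ofRealForm η) p = ((p.factorial * ∏ i : Fin p, d (Fin.castLE hp i) : ℕ) : ℂ) •
      (((γM : ↥(AddSubgroup.toIntSubmodule ((integralHodgeClassesIn Φ (2 * p) p).addSubgroupOf (integralForms Φ (2 * p))))) : ↥(integralForms Φ (2 * p))) : E [⋀^Fin (2 * p)]→L[ℝ] ℂ))
    (Λ : Submodule ℤ ↥(AddSubgroup.toIntSubmodule ((integralHodgeClassesIn Φ (2 * p) p).addSubgroupOf (integralForms Φ (2 * p))))) (hΛ : ∀ x, x ∈ Λ ↔ ∃ a : ℤ, a • γM = x)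
    (hall : ∀ x : ↥(AddSubgroup.toIntSubmodule ((integralHodgeClassesIn Φ (2 * p) p).addSubgroupOf (integralForms Φ (2 * p)))), ∃ a : ℤ, a • γM = x) :
    (LinearMap.range (B.restrict (AddSubgroup.toIntSubmodule ((integralHodgeClassesIn Φ (2 * p) p).addSubgroupOf (integralForms Φ (2 * p)))) γM)).toAddSubgroup.relIndex (LinearMap.range (B (γM : ↥(integralForms Φ (2 * p))))).toAddSubgroup = (j + 2).choose p ∧
      (Λ ⊔ (B.restrict (AddSubgroup.toIntSubmodule ((integralHodgeClassesIn Φ (2 * p) p).addSubgroupOf (integralForms Φ (2 * p))))).orthogonal Λ).toAddSubgroup.index = 1 :=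
  have hJ := index_line_sup_orthogonal_eq_one_of_forall_exists_smul (B.restrict (AddSubgroup.toIntSubmodule ((integralHodgeClassesIn Φ (2 * p) p).addSubgroupOf (integralForms Φ (2 * p))))) γM Λ hΛ hall
  ⟨eq_of_one_mul_eq₁₀₁ (hd.index_top_splitting_mul_relIndex_range_eq_choose hη h1 hp hq hpq hkq hγq e hn hB γM hγM Λ hΛ) hJ, hJ⟩

/-- **THE TOP SPLITTING ON A GENERAL POLARISED ABELIAN VARIETY, `dim_ℚ Bᵖ(X) = 1`** (Mattuck; e.g. `Hg(X) ⊇ Sp`, Lange Thm. 7.3.1): `Hdgᵖ(X, ℤ) = ℤγ_p`, so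
**`J_p = 1`, `γ_p^⊥ = 0`, `n_p · (p!·d₁⋯d_p)·((g−p)!·d₁⋯d_{g−p}) = g!·d₁⋯d_g`, `m_p = |B(γ_p, γ_p)|`, `m_p·(p!·d₁⋯d_p)²·(q!·d₁⋯d_q) = g!·d₁⋯d_g`.**
[cite: Lange2023AbelianVarietiesComplex, §7.3.1 Thm. 7.3.1, Prop. 7.3.3 (PDF pp. 336–337); §5.4.1 (5.22)–(5.23) (PDF p. 275); §2.5.3 Thm. 2.5.16, Cor. 2.5.17 (d) (PDF p. 135)]
[cite: BenoistDebarre2023SmoothSubvarietiesJacobians, §1 (p. 3); §3 proof of Thm. 3.7 (p. 7)] [cite: Kitaoka1993, Ch. 5 Prop. 5.3.3 (proof)] -/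
theorem IsPolarizationType.top_splitting_of_finrank_hodgeClasses_eq_one (hd : IsPolarizationType Φ η d) (hη : IsRiemannForm Φ η)
    (hp : p ≤ j + 2) (hq : q ≤ j + 2) (hpq : p + q ≤ j + 2) (hkq : 2 * p + q = j + 2) (hB1 : finrank ℚ ↥(hodgeClasses Φ p) = 1)
    {γq : E [⋀^Fin (2 * q)]→L[ℝ] ℂ} (hγq : wedgePow (ofRealForm η) q = ((q.factorial * ∏ i : Fin q, d (Fin.castLE hq i) : ℕ) : ℂ) • γq)
    (e : Fin n ≃ ι) (hn : 2 * p + (2 * q + 2 * p) = n) {B : BilinForm ℤ ↥(integralForms Φ (2 * p))}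
    (hB : ∀ x y : ↥(integralForms Φ (2 * p)),
      ((B x y : ℤ) : ℂ) = poincarePairing Φ e hn (x : E [⋀^Fin (2 * p)]→L[ℝ] ℂ) (γq.wedge (y : E [⋀^Fin (2 * p)]→L[ℝ] ℂ)))
    (γM : ↥(AddSubgroup.toIntSubmodule ((integralHodgeClassesIn Φ (2 * p) p).addSubgroupOf (integralForms Φ (2 * p)))))
    (hγM : wedgePow (ofRealForm η) p = ((p.factorial * ∏ i : Fin p, d (Fin.castLE hp i) : ℕ) : ℂ) •
      (((γM : ↥(AddSubgroup.toIntSubmodule ((integralHodgeClassesIn Φ (2 * p) p).addSubgroupOf (integralForms Φ (2 * p))))) : ↥(integralForms Φ (2 * p))) : E [⋀^Fin (2 * p)]→L[ℝ] ℂ))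
    (Λ : Submodule ℤ ↥(AddSubgroup.toIntSubmodule ((integralHodgeClassesIn Φ (2 * p) p).addSubgroupOf (integralForms Φ (2 * p))))) (hΛ : ∀ x, x ∈ Λ ↔ ∃ a : ℤ, a • γM = x) :
    (Λ ⊔ (B.restrict (AddSubgroup.toIntSubmodule ((integralHodgeClassesIn Φ (2 * p) p).addSubgroupOf (integralForms Φ (2 * p))))).orthogonal Λ).toAddSubgroup.index = 1 ∧
      (B.restrict (AddSubgroup.toIntSubmodule ((integralHodgeClassesIn Φ (2 * p) p).addSubgroupOf (integralForms Φ (2 * p))))).orthogonal Λ = ⊥ ∧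
      ((LinearMap.range (B.restrict (AddSubgroup.toIntSubmodule ((integralHodgeClassesIn Φ (2 * p) p).addSubgroupOf (integralForms Φ (2 * p)))) γM)).toAddSubgroup.relIndex (LinearMap.range (B (γM : ↥(integralForms Φ (2 * p))))).toAddSubgroup) * ((p.factorial * ∏ i : Fin p, d (Fin.castLE hp i)) * ((p + q).factorial * ∏ i : Fin (p + q), d (Fin.castLE hpq i))) = (j + 2).factorial * ∏ i, d i ∧
      (LinearMap.range (B.restrict (AddSubgroup.toIntSubmodule ((integralHodgeClassesIn Φ (2 * p) p).addSubgroupOf (integralForms Φ (2 * p)))) γM)).toAddSubgroup.index = (B (γM : ↥(integralForms Φ (2 * p))) (γM : ↥(integralForms Φ (2 * p)))).natAbs ∧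
      (LinearMap.range (B.restrict (AddSubgroup.toIntSubmodule ((integralHodgeClassesIn Φ (2 * p) p).addSubgroupOf (integralForms Φ (2 * p)))) γM)).toAddSubgroup.index * ((p.factorial * ∏ i : Fin p, d (Fin.castLE hp i)) ^ 2 * (q.factorial * ∏ i : Fin q, d (Fin.castLE hq i))) = (j + 2).factorial * ∏ i, d i :=
  hd.top_splitting_of_forall_exists_smul hη hp hq hpq hkq hγq e hn hB γM hγM Λ hΛ
    (hd.exists_int_smul_minimalClass_eq_of_finrank_hodgeClasses_eq_one hη hp hB1 γM hγM)

/-- **THE TOP SPLITTING WHEN `Sp(Λ_ℝ, E) ⊆ Hg(X)`** (the general member of the moduli space `A_D`, Lange Prop. 7.3.3 ⟹ Thm. 7.3.1 `Bᵖ(X) = ℚθ^p`):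
`J_p = 1`, `γ_p^⊥ = 0`, `n_p · (p!·d₁⋯d_p)·((g−p)!·d₁⋯d_{g−p}) = g!·d₁⋯d_g`, `m_p = |B(γ_p, γ_p)|`.
[cite: Lange2023AbelianVarietiesComplex, §7.3.1 Thm. 7.3.1, Prop. 7.3.2, Prop. 7.3.3 (PDF pp. 336–337); §5.4.1 (5.22)–(5.23) (PDF p. 275); §2.5.3 Cor. 2.5.17 (d) (PDF p. 135)] [cite: Kitaoka1993, Ch. 5 Prop. 5.3.3 (proof)] -/
theorem IsPolarizationType.top_splitting_of_spGroup_le [FiniteDimensional ℂ E] (hd : IsPolarizationType Φ η d) (hη : IsRiemannForm Φ η)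
    (hHg : spGroup Φ η ≤ hodgeGroup Φ) (hp : p ≤ j + 2) (hq : q ≤ j + 2) (hpq : p + q ≤ j + 2) (hkq : 2 * p + q = j + 2)
    {γq : E [⋀^Fin (2 * q)]→L[ℝ] ℂ} (hγq : wedgePow (ofRealForm η) q = ((q.factorial * ∏ i : Fin q, d (Fin.castLE hq i) : ℕ) : ℂ) • γq)
    (e : Fin n ≃ ι) (hn : 2 * p + (2 * q + 2 * p) = n) {B : BilinForm ℤ ↥(integralForms Φ (2 * p))}
    (hB : ∀ x y : ↥(integralForms Φ (2 * p)),
      ((B x y : ℤ) : ℂ) = poincarePairing Φ e hn (x : E [⋀^Fin (2 * p)]→L[ℝ] ℂ) (γq.wedge (y : E [⋀^Fin (2 * p)]→L[ℝ] ℂ)))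
    (γM : ↥(AddSubgroup.toIntSubmodule ((integralHodgeClassesIn Φ (2 * p) p).addSubgroupOf (integralForms Φ (2 * p)))))
    (hγM : wedgePow (ofRealForm η) p = ((p.factorial * ∏ i : Fin p, d (Fin.castLE hp i) : ℕ) : ℂ) •
      (((γM : ↥(AddSubgroup.toIntSubmodule ((integralHodgeClassesIn Φ (2 * p) p).addSubgroupOf (integralForms Φ (2 * p))))) : ↥(integralForms Φ (2 * p))) : E [⋀^Fin (2 * p)]→L[ℝ] ℂ))
    (Λ : Submodule ℤ ↥(AddSubgroup.toIntSubmodule ((integralHodgeClassesIn Φ (2 * p) p).addSubgroupOf (integralForms Φ (2 * p))))) (hΛ : ∀ x, x ∈ Λ ↔ ∃ a : ℤ, a • γM = x) :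
    (Λ ⊔ (B.restrict (AddSubgroup.toIntSubmodule ((integralHodgeClassesIn Φ (2 * p) p).addSubgroupOf (integralForms Φ (2 * p))))).orthogonal Λ).toAddSubgroup.index = 1 ∧
      (B.restrict (AddSubgroup.toIntSubmodule ((integralHodgeClassesIn Φ (2 * p) p).addSubgroupOf (integralForms Φ (2 * p))))).orthogonal Λ = ⊥ ∧
      ((LinearMap.range (B.restrict (AddSubgroup.toIntSubmodule ((integralHodgeClassesIn Φ (2 * p) p).addSubgroupOf (integralForms Φ (2 * p)))) γM)).toAddSubgroup.relIndex (LinearMap.range (B (γM : ↥(integralForms Φ (2 * p))))).toAddSubgroup) * ((p.factorial * ∏ i : Fin p, d (Fin.castLE hp i)) * ((p + q).factorial * ∏ i : Fin (p + q), d (Fin.castLE hpq i))) = (j + 2).factorial * ∏ i, d i ∧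
      (LinearMap.range (B.restrict (AddSubgroup.toIntSubmodule ((integralHodgeClassesIn Φ (2 * p) p).addSubgroupOf (integralForms Φ (2 * p)))) γM)).toAddSubgroup.index = (B (γM : ↥(integralForms Φ (2 * p))) (γM : ↥(integralForms Φ (2 * p)))).natAbs ∧
      (LinearMap.range (B.restrict (AddSubgroup.toIntSubmodule ((integralHodgeClassesIn Φ (2 * p) p).addSubgroupOf (integralForms Φ (2 * p)))) γM)).toAddSubgroup.index * ((p.factorial * ∏ i : Fin p, d (Fin.castLE hp i)) ^ 2 * (q.factorial * ∏ i : Fin q, d (Fin.castLE hq i))) = (j + 2).factorial * ∏ i, d i :=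
  hd.top_splitting_of_finrank_hodgeClasses_eq_one hη hp hq hpq hkq (hd.finrank_hodgeClasses_eq_one_of_spGroup_le hη hHg hp) hγq e hn hB γM hγM Λ hΛ

end General

/-! ## §3 The minimal-class decomposition is exact on a general polarised abelian variety: `D_p = 1`, `I'_p = 1`, `I_p = ∏_s (s!·d₁⋯d_s)^{ρ_pr^{(p−s)}}` -/

section Defect

variable {ι : Type*} [Fintype ι] [DecidableEq ι] {E : Type*} [NormedAddCommGroup E] [NormedSpace ℂ E]
  {Φ : (ι → ℝ) ≃L[ℝ] E} {j n p q : ℕ} {η : E [⋀^Fin 2]→L[ℝ] ℝ} {d : Fin (j + 2) → ℕ}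

/-- `I = P · I'` with `I' = 1` gives `I = P`. [folklore] -/
private theorem eq_of_eq_mul_of_eq_one₁₀₁ {I P I' : ℕ} (h : I = P * I') (h1 : I' = 1) : I = P := by
  subst h1; simpa using h

/-- **WHEN `Hdgᵖ(X, ℤ) = ℤγ_p` THE MINIMAL-CLASS DECOMPOSITION OF THE HODGE LATTICE IS EXACT** (`2p + q = g`; `M_s = γ_s ∧ Hdg^{p−s}(X, ℤ)_prim`,
`N_s = θ^{∧s} ∧ Hdg^{p−s}(X, ℤ)_prim = (s!·d₁⋯d_s)·M_s` the pieces of Lange's (5.22) read on `Hdgᵖ(X, ℤ)`): the lower pieces `⊕_{s<p} M_s ⊆ γ_p^⊥ = 0` vanish inside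
`Hdgᵖ(X, ℤ)`, the defect **`D_p = [γ_p^⊥ : ⊕_{s<p} M_s] = 1`**, the index **`I'_p = [Hdgᵖ(X, ℤ) : ⊕_s M_s] = J_p · D_p = 1`** (g49-#2; both currencies), and the index of
(5.22) itself is the pure content factor of g48-#4: **`I_p = [Hdgᵖ(X, ℤ) : ⊕_s θ^{∧s} ∧ Hdg^{p−s}(X, ℤ)_prim] = ∏_{s ≤ p} (s!·d₁⋯d_s)^{ρ_pr^{(p−s)}}`**,
`ρ_pr^{(i)} = rk (Hdgⁱ(X, ℤ) ∩ P^{2i})`. [cite: Lange2023AbelianVarietiesComplex, §5.4.1 Thm. 5.4.2 and (5.22)–(5.23) (PDF p. 275); §7.3.1 Thm. 7.3.1 (PDF p. 336); §2.5.3 Thm. 2.5.16, Cor. 2.5.17 (PDF p. 135)]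
[cite: BenoistDebarre2023SmoothSubvarietiesJacobians, §1 (p. 3); §3 proof of Thm. 3.7 (p. 7)] [cite: Huybrechts2016K3, Ch. 14 §0.1–§0.2] -/
theorem IsPolarizationType.index_comap_iSup_minimalClassPieces_eq_one_of_forall_exists_smul (hd : IsPolarizationType Φ η d) (hη : IsRiemannForm Φ η)
    (hp : p ≤ j + 2) (hq : q ≤ j + 2) (hpq : p + q ≤ j + 2) (hkq : 2 * p + q = j + 2)
    {γq : E [⋀^Fin (2 * q)]→L[ℝ] ℂ} (hγq : wedgePow (ofRealForm η) q = ((q.factorial * ∏ i : Fin q, d (Fin.castLE hq i) : ℕ) : ℂ) • γq)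
    (e : Fin n ≃ ι) (hn : 2 * p + (2 * q + 2 * p) = n) {B : BilinForm ℤ ↥(integralForms Φ (2 * p))}
    (hB : ∀ x y : ↥(integralForms Φ (2 * p)),
      ((B x y : ℤ) : ℂ) = poincarePairing Φ e hn (x : E [⋀^Fin (2 * p)]→L[ℝ] ℂ) (γq.wedge (y : E [⋀^Fin (2 * p)]→L[ℝ] ℂ)))
    (γM : ↥(AddSubgroup.toIntSubmodule ((integralHodgeClassesIn Φ (2 * p) p).addSubgroupOf (integralForms Φ (2 * p)))))
    (hγM : wedgePow (ofRealForm η) p = ((p.factorial * ∏ i : Fin p, d (Fin.castLE hp i) : ℕ) : ℂ) •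
      (((γM : ↥(AddSubgroup.toIntSubmodule ((integralHodgeClassesIn Φ (2 * p) p).addSubgroupOf (integralForms Φ (2 * p))))) : ↥(integralForms Φ (2 * p))) : E [⋀^Fin (2 * p)]→L[ℝ] ℂ))
    (Λ : Submodule ℤ ↥(AddSubgroup.toIntSubmodule ((integralHodgeClassesIn Φ (2 * p) p).addSubgroupOf (integralForms Φ (2 * p))))) (hΛ : ∀ x, x ∈ Λ ↔ ∃ a : ℤ, a • γM = x)
    (hall : ∀ x : ↥(AddSubgroup.toIntSubmodule ((integralHodgeClassesIn Φ (2 * p) p).addSubgroupOf (integralForms Φ (2 * p)))), ∃ a : ℤ, a • γM = x)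
    (N : Fin (p + 1) → Submodule ℤ ↥(integralForms Φ (2 * p)))
    (hN : ∀ (s : Fin (p + 1)) (u : ↥(integralForms Φ (2 * p))), u ∈ N s ↔
      ∃ (m i : ℕ) (_ : i + i = m) (h : 2 * (s : ℕ) + m = 2 * p) (y : E [⋀^Fin m]→L[ℝ] ℂ),
        y ∈ integralHodgeClassesIn Φ m i ∧ y ∈ primitiveForms η m ∧ (u : E [⋀^Fin (2 * p)]→L[ℝ] ℂ) = lefschetzPow η (s : ℕ) h y)
    (M : Fin (p + 1) → Submodule ℤ ↥(integralForms Φ (2 * p)))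
    (hM : ∀ (s : Fin (p + 1)) (u : ↥(integralForms Φ (2 * p))), u ∈ M s ↔
      ((s : ℕ).factorial * ∏ i : Fin s, d (Fin.castLE ((Nat.le_of_lt_succ s.isLt).trans hp) i)) • u ∈ N s) :
    (⨆ s : Fin p, M (Fin.castSucc s)).comap (AddSubgroup.toIntSubmodule ((integralHodgeClassesIn Φ (2 * p) p).addSubgroupOf (integralForms Φ (2 * p)))).subtype = ⊥ ∧
      ((⨆ s : Fin p, M (Fin.castSucc s)).comap (AddSubgroup.toIntSubmodule ((integralHodgeClassesIn Φ (2 * p) p).addSubgroupOf (integralForms Φ (2 * p)))).subtype).toAddSubgroup.relIndex ((B.restrict (AddSubgroup.toIntSubmodule ((integralHodgeClassesIn Φ (2 * p) p).addSubgroupOf (integralForms Φ (2 * p))))).orthogonal Λ).toAddSubgroup = 1 ∧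
      ((⨆ s, M s).comap (AddSubgroup.toIntSubmodule ((integralHodgeClassesIn Φ (2 * p) p).addSubgroupOf (integralForms Φ (2 * p)))).subtype).toAddSubgroup.index = 1 ∧
      ((⨆ s, M s).comap (AddSubgroup.inclusion (integralHodgeClassesIn_le_integralForms Φ (2 * p) p)).toIntLinearMap).toAddSubgroup.index = 1 ∧
      ((⨆ s, N s).comap (AddSubgroup.inclusion (integralHodgeClassesIn_le_integralForms Φ (2 * p) p)).toIntLinearMap).toAddSubgroup.index =
        ∏ s : Fin (p + 1), ((s : ℕ).factorial * ∏ i : Fin s, d (Fin.castLE ((Nat.le_of_lt_succ s.isLt).trans hp) i)) ^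
          finrank ℤ ↥(integralHodgeClassesIn Φ (2 * (p - (s : ℕ))) (p - (s : ℕ)) ⊓ (primitiveForms η (2 * (p - (s : ℕ)))).toAddSubgroup) := by
  have hmain := hd.top_splitting_of_forall_exists_smul hη hp hq hpq hkq hγq e hn hB γM hγM Λ hΛ hall
  have h2 := hd.index_comap_iSup_minimalClassPieces_eq_index_top_splitting_mul_relIndex_lower hη hp hkq hq hγq e hn hB γM hγM Λ hΛ N hN M hM
  have hlow := hd.comap_subtype_lower_minimalClassPieces_le_orthogonal hη hp hkq hq hγq e hn hB γM hγM Λ hΛ N hN M hM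
  have h4 := hd.index_comap_iSup_lefschetzPieces_eq_prod_mul hη (two_mul p).symm (show 2 * p ≤ j + 2 by omega) N hN hp M hM
  have hObot : ((B.restrict (AddSubgroup.toIntSubmodule ((integralHodgeClassesIn Φ (2 * p) p).addSubgroupOf (integralForms Φ (2 * p))))).orthogonal Λ).toAddSubgroup = ⊥ := (congrArg Submodule.toAddSubgroup hmain.2.1).trans Submodule.bot_toAddSubgroup
  have hD : ((⨆ s : Fin p, M (Fin.castSucc s)).comap (AddSubgroup.toIntSubmodule ((integralHodgeClassesIn Φ (2 * p) p).addSubgroupOf (integralForms Φ (2 * p)))).subtype).toAddSubgroup.relIndex ((B.restrict (AddSubgroup.toIntSubmodule ((integralHodgeClassesIn Φ (2 * p) p).addSubgroupOf (integralForms Φ (2 * p))))).orthogonal Λ).toAddSubgroup = 1 :=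
    (congrArg (fun K ↦ ((⨆ s : Fin p, M (Fin.castSucc s)).comap (AddSubgroup.toIntSubmodule ((integralHodgeClassesIn Φ (2 * p) p).addSubgroupOf (integralForms Φ (2 * p)))).subtype).toAddSubgroup.relIndex K) hObot).trans (AddSubgroup.relIndex_bot_right _)
  have hI' := eq_one_of_eq_mul₁₀₁ h2.2.1 hmain.1 hD
  exact ⟨eq_bot_iff.2 (hlow.trans hmain.2.1.le), hD, eq_one_of_eq_mul₁₀₁ h2.1 hmain.1 hD, hI', eq_of_eq_mul_of_eq_one₁₀₁ h4.1 hI'⟩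

/-- **ON A GENERAL POLARISED ABELIAN VARIETY (`dim_ℚ Bᵖ(X) = 1`) THE MINIMAL-CLASS DECOMPOSITION OF `Hdgᵖ(X, ℤ)` IS EXACT**: `⊕_{s<p} M_s = 0` in `Hdgᵖ(X, ℤ)`,
`D_p = 1`, `I'_p = 1`, and `I_p = [Hdgᵖ(X, ℤ) : ⊕_s θ^{∧s} ∧ Hdg^{p−s}(X, ℤ)_prim] = ∏_{s ≤ p} (s!·d₁⋯d_s)^{ρ_pr^{(p−s)}}`.
[cite: Lange2023AbelianVarietiesComplex, §7.3.1 Thm. 7.3.1, Prop. 7.3.3 (PDF pp. 336–337); §5.4.1 Thm. 5.4.2 and (5.22)–(5.23) (PDF p. 275); §2.5.3 Thm. 2.5.16 (PDF p. 135)]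
[cite: BenoistDebarre2023SmoothSubvarietiesJacobians, §3 proof of Thm. 3.7 (p. 7)] [cite: Huybrechts2016K3, Ch. 14 §0.1–§0.2] -/
theorem IsPolarizationType.index_comap_iSup_minimalClassPieces_eq_one_of_finrank_hodgeClasses_eq_one (hd : IsPolarizationType Φ η d)
    (hη : IsRiemannForm Φ η) (hp : p ≤ j + 2) (hq : q ≤ j + 2) (hpq : p + q ≤ j + 2) (hkq : 2 * p + q = j + 2) (hB1 : finrank ℚ ↥(hodgeClasses Φ p) = 1)
    {γq : E [⋀^Fin (2 * q)]→L[ℝ] ℂ} (hγq : wedgePow (ofRealForm η) q = ((q.factorial * ∏ i : Fin q, d (Fin.castLE hq i) : ℕ) : ℂ) • γq)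
    (e : Fin n ≃ ι) (hn : 2 * p + (2 * q + 2 * p) = n) {B : BilinForm ℤ ↥(integralForms Φ (2 * p))}
    (hB : ∀ x y : ↥(integralForms Φ (2 * p)),
      ((B x y : ℤ) : ℂ) = poincarePairing Φ e hn (x : E [⋀^Fin (2 * p)]→L[ℝ] ℂ) (γq.wedge (y : E [⋀^Fin (2 * p)]→L[ℝ] ℂ)))
    (γM : ↥(AddSubgroup.toIntSubmodule ((integralHodgeClassesIn Φ (2 * p) p).addSubgroupOf (integralForms Φ (2 * p)))))
    (hγM : wedgePow (ofRealForm η) p = ((p.factorial * ∏ i : Fin p, d (Fin.castLE hp i) : ℕ) : ℂ) •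
      (((γM : ↥(AddSubgroup.toIntSubmodule ((integralHodgeClassesIn Φ (2 * p) p).addSubgroupOf (integralForms Φ (2 * p))))) : ↥(integralForms Φ (2 * p))) : E [⋀^Fin (2 * p)]→L[ℝ] ℂ))
    (Λ : Submodule ℤ ↥(AddSubgroup.toIntSubmodule ((integralHodgeClassesIn Φ (2 * p) p).addSubgroupOf (integralForms Φ (2 * p))))) (hΛ : ∀ x, x ∈ Λ ↔ ∃ a : ℤ, a • γM = x)
    (N : Fin (p + 1) → Submodule ℤ ↥(integralForms Φ (2 * p)))
    (hN : ∀ (s : Fin (p + 1)) (u : ↥(integralForms Φ (2 * p))), u ∈ N s ↔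
      ∃ (m i : ℕ) (_ : i + i = m) (h : 2 * (s : ℕ) + m = 2 * p) (y : E [⋀^Fin m]→L[ℝ] ℂ),
        y ∈ integralHodgeClassesIn Φ m i ∧ y ∈ primitiveForms η m ∧ (u : E [⋀^Fin (2 * p)]→L[ℝ] ℂ) = lefschetzPow η (s : ℕ) h y)
    (M : Fin (p + 1) → Submodule ℤ ↥(integralForms Φ (2 * p)))
    (hM : ∀ (s : Fin (p + 1)) (u : ↥(integralForms Φ (2 * p))), u ∈ M s ↔
      ((s : ℕ).factorial * ∏ i : Fin s, d (Fin.castLE ((Nat.le_of_lt_succ s.isLt).trans hp) i)) • u ∈ N s) :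
    (⨆ s : Fin p, M (Fin.castSucc s)).comap (AddSubgroup.toIntSubmodule ((integralHodgeClassesIn Φ (2 * p) p).addSubgroupOf (integralForms Φ (2 * p)))).subtype = ⊥ ∧
      ((⨆ s : Fin p, M (Fin.castSucc s)).comap (AddSubgroup.toIntSubmodule ((integralHodgeClassesIn Φ (2 * p) p).addSubgroupOf (integralForms Φ (2 * p)))).subtype).toAddSubgroup.relIndex ((B.restrict (AddSubgroup.toIntSubmodule ((integralHodgeClassesIn Φ (2 * p) p).addSubgroupOf (integralForms Φ (2 * p))))).orthogonal Λ).toAddSubgroup = 1 ∧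
      ((⨆ s, M s).comap (AddSubgroup.toIntSubmodule ((integralHodgeClassesIn Φ (2 * p) p).addSubgroupOf (integralForms Φ (2 * p)))).subtype).toAddSubgroup.index = 1 ∧
      ((⨆ s, M s).comap (AddSubgroup.inclusion (integralHodgeClassesIn_le_integralForms Φ (2 * p) p)).toIntLinearMap).toAddSubgroup.index = 1 ∧
      ((⨆ s, N s).comap (AddSubgroup.inclusion (integralHodgeClassesIn_le_integralForms Φ (2 * p) p)).toIntLinearMap).toAddSubgroup.index =
        ∏ s : Fin (p + 1), ((s : ℕ).factorial * ∏ i : Fin s, d (Fin.castLE ((Nat.le_of_lt_succ s.isLt).trans hp) i)) ^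
          finrank ℤ ↥(integralHodgeClassesIn Φ (2 * (p - (s : ℕ))) (p - (s : ℕ)) ⊓ (primitiveForms η (2 * (p - (s : ℕ)))).toAddSubgroup) :=
  hd.index_comap_iSup_minimalClassPieces_eq_one_of_forall_exists_smul hη hp hq hpq hkq hγq e hn hB γM hγM Λ hΛ
    (hd.exists_int_smul_minimalClass_eq_of_finrank_hodgeClasses_eq_one hη hp hB1 γM hγM) N hN M hM

end Defect

/-! ## §4 No primitive integral Hodge classes in positive degree; `I_p = p!·d₁⋯d_p` on a general polarised abelian variety -/

section Primitive

variable {ι : Type*} [Fintype ι] [DecidableEq ι] {E : Type*} [NormedAddCommGroup E] [NormedSpace ℂ E]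
  {Φ : (ι → ℝ) ≃L[ℝ] E} {j n p q : ℕ} {η : E [⋀^Fin 2]→L[ℝ] ℝ} {d : Fin (j + 2) → ℕ}

omit [Fintype ι] [DecidableEq ι] in
/-- `ψ.domDomCongr σ = 0 ⟹ ψ = 0` (re-indexing is injective). [folklore] -/
private theorem eq_zero_of_domDomCongr_eq_zero₁₀₁ {a b : ℕ} (σ : Fin a ≃ Fin b) (ψ : E [⋀^Fin a]→L[ℝ] ℂ) (h : ψ.domDomCongr σ = 0) : ψ = 0 := by
  ext v
  have hv := congrArg (fun φ : E [⋀^Fin b]→L[ℝ] ℂ ↦ φ (v ∘ σ.symm)) h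
  simpa only [ContinuousAlternatingMap.domDomCongr_apply, Function.comp_assoc, Equiv.symm_comp_self, Function.comp_id, ContinuousAlternatingMap.coe_zero,
    Pi.zero_apply] using hv

/-- **NO PRIMITIVE INTEGRAL HODGE CLASSES OF CODIMENSION `1 ≤ i ≤ g − 1` WHEN `dim_ℚ Bⁱ(X) = 1`: `Hdgⁱ(X, ℤ) ∩ P^{2i} = 0`.** For then `Hdgⁱ(X, ℤ) = ℤγ_i`
(`θ^{∧i} = (i!·d₁⋯d_i)·γ_i`, g36-#1), and a multiple `aγ_i` is primitive iff `θ^{∧(g−2i+1)} ∧ aγ_i = 0`, i.e. `a·θ^{∧(g−i+1)} = 0`, i.e. `a = 0` since `θ^{∧m} ≠ 0` for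
`m = g − i + 1 ≤ g` (Lange §7.3.2: `Pᵏ = ker L^{g−k+1}`; on a general polarised abelian variety all of `H^{2i}_Hodge = ℚθ^i` is Lefschetz-imprimitive for `0 < i < g`).
[cite: Lange2023AbelianVarietiesComplex, §7.3.2 (primitive forms); §7.3.1 Thm. 7.3.1 (PDF p. 336); §2.5.3 Thm. 2.5.16 (PDF p. 135)] [cite: VoisinHodgeI2002, §6.2.3 Prop. 6.22, Rem. 6.27 (PDF p. 126)] -/
theorem IsPolarizationType.integralHodgeClassesIn_inf_primitiveForms_eq_bot_of_finrank_hodgeClasses_eq_one [FiniteDimensional ℂ E]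
    (hd : IsPolarizationType Φ η d) (hη : IsRiemannForm Φ η) {i : ℕ} (hi1 : 1 ≤ i) (hig : i + 1 ≤ j + 2) (hB1 : finrank ℚ ↥(hodgeClasses Φ i) = 1) :
    integralHodgeClassesIn Φ (2 * i) i ⊓ (primitiveForms η (2 * i)).toAddSubgroup = ⊥ := by
  have hi : i ≤ j + 2 := by omega
  have hfin : finrank ℂ E = j + 2 := finrank_complex_eq₁₀₁ hd
  obtain ⟨γ, hγZ, hγ⟩ := hd.exists_mem_integralForms_wedgePow_eq_content_smul hi
  have hzm := hd.integralHodgeClasses_eq_zmultiples_of_finrank_eq_one hη hi hγZ hγ hB1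
  refine (AddSubgroup.eq_bot_iff_forall _).2 fun y hy ↦ ?_
  have hyH : y ∈ integralHodgeClasses Φ i := hy.1
  rw [hzm, AddSubgroup.mem_zmultiples_iff] at hyH
  obtain ⟨a, rfl⟩ := hyH
  have hprim : (wedgePow (ofRealForm η) (finrank ℂ E - 2 * i + 1)).wedge (a • γ) = 0 := (mem_primitiveForms_iff η _).1 hy.2
  rw [← Int.cast_smul_eq_zsmul ℂ a γ, wedge_smul_right_complex] at hprim
  -- `θ^{∧m} ∧ θ^{∧i} ≠ 0`, `m = g − 2i + 1`, since `θ^{∧(m+i)} ≠ 0` (`m + i ≤ g`)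
  have hne : (wedgePow (ofRealForm η) (finrank ℂ E - 2 * i + 1)).wedge (wedgePow (ofRealForm η) i) ≠ 0 := fun h0 ↦ by
    rw [wedgePow_wedge_wedgePow] at h0
    exact hη.wedgePow_ofRealForm_ne_zero (show finrank ℂ E - 2 * i + 1 + i ≤ finrank ℂ E by omega) (eq_zero_of_domDomCongr_eq_zero₁₀₁ _ _ h0)
  rw [hγ, wedge_smul_right_complex] at hne
  rcases eq_or_ne a 0 with ha | ha
  · rw [ha, zero_zsmul]
  · exact absurd (smul_eq_zero_of_right _ ((smul_eq_zero.1 hprim).resolve_left (Int.cast_ne_zero.2 ha))) hne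

/-- **`ρ_pr^{(i)} = rk (Hdgⁱ(X, ℤ) ∩ P^{2i}) = 0` for `1 ≤ i ≤ g − 1` when `dim_ℚ Bⁱ(X) = 1`.** [cite: Lange2023AbelianVarietiesComplex, §7.3.2; §7.3.1 Thm. 7.3.1 (PDF p. 336); §5.4.1 (5.22) (PDF p. 275)] -/
theorem IsPolarizationType.finrank_integralHodgeClassesIn_inf_primitiveForms_eq_zero_of_finrank_hodgeClasses_eq_one [FiniteDimensional ℂ E]
    (hd : IsPolarizationType Φ η d) (hη : IsRiemannForm Φ η) {i : ℕ} (hi1 : 1 ≤ i) (hig : i + 1 ≤ j + 2) (hB1 : finrank ℚ ↥(hodgeClasses Φ i) = 1) :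
    finrank ℤ ↥(integralHodgeClassesIn Φ (2 * i) i ⊓ (primitiveForms η (2 * i)).toAddSubgroup) = 0 := by
  have h := hd.integralHodgeClassesIn_inf_primitiveForms_eq_bot_of_finrank_hodgeClasses_eq_one hη hi1 hig hB1
  haveI : Subsingleton ↥(integralHodgeClassesIn Φ (2 * i) i ⊓ (primitiveForms η (2 * i)).toAddSubgroup) :=
    ⟨fun x y ↦ Subtype.ext ((((AddSubgroup.eq_bot_iff_forall _).1 h) x x.2).trans (((AddSubgroup.eq_bot_iff_forall _).1 h) y y.2).symm)⟩
  exact finrank_zero_of_subsingleton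

omit [DecidableEq ι] in
variable (Φ η) in
/-- `ρ_pr^{(0)} = 1`, transported along `i = 0`. [cite: Lange2023AbelianVarietiesComplex, §5.4.1 (5.22) (PDF p. 275)] -/
private theorem finrank_inf_primitiveForms_eq_one_of_eq_zero₁₀₁ {i : ℕ} (hi : i = 0) :
    finrank ℤ ↥(integralHodgeClassesIn Φ (2 * i) i ⊓ (primitiveForms η (2 * i)).toAddSubgroup) = 1 := by
  subst hi
  exact finrank_integralHodgeClassesIn_inf_primitiveForms_zero Φ η

/-- **The content product collapses: `∏_{s ≤ p} (s!·d₁⋯d_s)^{ρ_pr^{(p−s)}} = p!·d₁⋯d_p` when `ρ_pr^{(i)} = 0` for `1 ≤ i ≤ p` (and `ρ_pr^{(0)} = 1`).**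
[cite: Lange2023AbelianVarietiesComplex, §5.4.1 (5.22) (PDF p. 275); §7.3.1 Thm. 7.3.1 (PDF p. 336)] -/
theorem IsPolarizationType.prod_content_pow_finrank_primitive_eq_content [FiniteDimensional ℂ E] (hd : IsPolarizationType Φ η d) (hη : IsRiemannForm Φ η)
    (hp : p ≤ j + 2) (hp1 : p + 1 ≤ j + 2) (hB1 : ∀ i, 1 ≤ i → i ≤ p → finrank ℚ ↥(hodgeClasses Φ i) = 1) :
    ∏ s : Fin (p + 1), ((s : ℕ).factorial * ∏ i : Fin s, d (Fin.castLE ((Nat.le_of_lt_succ s.isLt).trans hp) i)) ^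
        finrank ℤ ↥(integralHodgeClassesIn Φ (2 * (p - (s : ℕ))) (p - (s : ℕ)) ⊓ (primitiveForms η (2 * (p - (s : ℕ)))).toAddSubgroup) =
      p.factorial * ∏ i : Fin p, d (Fin.castLE hp i) := by
  rw [Fin.prod_univ_castSucc, Finset.prod_eq_one fun s _ ↦ ?_, one_mul]
  · rw [finrank_inf_primitiveForms_eq_one_of_eq_zero₁₀₁ Φ η (i := p - (Fin.last p : ℕ)) (Nat.sub_self p), pow_one]
    rfl
  · have hs := s.isLt
    rw [hd.finrank_integralHodgeClassesIn_inf_primitiveForms_eq_zero_of_finrank_hodgeClasses_eq_one hη (i := p - (Fin.castSucc s : ℕ))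
      (by simp only [Fin.val_castSucc]; omega) (by simp only [Fin.val_castSucc]; omega) (hB1 _ (by simp only [Fin.val_castSucc]; omega) (Nat.sub_le _ _)), pow_zero]

/-- **THE HODGE LATTICE OF A GENERAL POLARISED ABELIAN VARIETY, ALL INDICES** (`dim_ℚ Bⁱ(X) = 1` for `1 ≤ i ≤ p`, `2p + q = g`): `Hdgᵖ(X, ℤ) = ℤγ_p`,
**`J_p = 1`**, **`n_p · (p!·d₁⋯d_p)·((g−p)!·d₁⋯d_{g−p}) = g!·d₁⋯d_g`**, the minimal-class decomposition is exact (**`I'_p = 1`**), and the index of Lange's integral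
Lefschetz decomposition (5.22) `⊕_s θ^{∧s} ∧ Hdg^{p−s}(X, ℤ)_prim = ℤθ^{∧p} ⊆ Hdgᵖ(X, ℤ) = ℤγ_p` is exactly the content: **`I_p = p!·d₁⋯d_p`**.
[cite: Lange2023AbelianVarietiesComplex, §7.3.1 Thm. 7.3.1, Prop. 7.3.3 (PDF pp. 336–337); §5.4.1 Thm. 5.4.2 and (5.22)–(5.23) (PDF p. 275); §2.5.3 Thm. 2.5.16, Cor. 2.5.17 (d) (PDF p. 135)]
[cite: BenoistDebarre2023SmoothSubvarietiesJacobians, §1 (p. 3); §3 proof of Thm. 3.7 (p. 7)] [cite: Kitaoka1993, Ch. 5 Prop. 5.3.3 (proof)] [cite: Huybrechts2016K3, Ch. 14 §0.1–§0.2] -/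
theorem IsPolarizationType.index_comap_iSup_lefschetzPieces_eq_content_of_finrank_hodgeClasses_eq_one [FiniteDimensional ℂ E] (hd : IsPolarizationType Φ η d)
    (hη : IsRiemannForm Φ η) (hp : p ≤ j + 2) (hq : q ≤ j + 2) (hpq : p + q ≤ j + 2) (hkq : 2 * p + q = j + 2) (hp1 : p + 1 ≤ j + 2)
    (hB1 : ∀ i, 1 ≤ i → i ≤ p → finrank ℚ ↥(hodgeClasses Φ i) = 1) (hBp : finrank ℚ ↥(hodgeClasses Φ p) = 1)
    {γq : E [⋀^Fin (2 * q)]→L[ℝ] ℂ} (hγq : wedgePow (ofRealForm η) q = ((q.factorial * ∏ i : Fin q, d (Fin.castLE hq i) : ℕ) : ℂ) • γq)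
    (e : Fin n ≃ ι) (hn : 2 * p + (2 * q + 2 * p) = n) {B : BilinForm ℤ ↥(integralForms Φ (2 * p))}
    (hB : ∀ x y : ↥(integralForms Φ (2 * p)),
      ((B x y : ℤ) : ℂ) = poincarePairing Φ e hn (x : E [⋀^Fin (2 * p)]→L[ℝ] ℂ) (γq.wedge (y : E [⋀^Fin (2 * p)]→L[ℝ] ℂ)))
    (γM : ↥(AddSubgroup.toIntSubmodule ((integralHodgeClassesIn Φ (2 * p) p).addSubgroupOf (integralForms Φ (2 * p)))))
    (hγM : wedgePow (ofRealForm η) p = ((p.factorial * ∏ i : Fin p, d (Fin.castLE hp i) : ℕ) : ℂ) •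
      (((γM : ↥(AddSubgroup.toIntSubmodule ((integralHodgeClassesIn Φ (2 * p) p).addSubgroupOf (integralForms Φ (2 * p))))) : ↥(integralForms Φ (2 * p))) : E [⋀^Fin (2 * p)]→L[ℝ] ℂ))
    (Λ : Submodule ℤ ↥(AddSubgroup.toIntSubmodule ((integralHodgeClassesIn Φ (2 * p) p).addSubgroupOf (integralForms Φ (2 * p))))) (hΛ : ∀ x, x ∈ Λ ↔ ∃ a : ℤ, a • γM = x)
    (N : Fin (p + 1) → Submodule ℤ ↥(integralForms Φ (2 * p)))
    (hN : ∀ (s : Fin (p + 1)) (u : ↥(integralForms Φ (2 * p))), u ∈ N s ↔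
      ∃ (m i : ℕ) (_ : i + i = m) (h : 2 * (s : ℕ) + m = 2 * p) (y : E [⋀^Fin m]→L[ℝ] ℂ),
        y ∈ integralHodgeClassesIn Φ m i ∧ y ∈ primitiveForms η m ∧ (u : E [⋀^Fin (2 * p)]→L[ℝ] ℂ) = lefschetzPow η (s : ℕ) h y)
    (M : Fin (p + 1) → Submodule ℤ ↥(integralForms Φ (2 * p)))
    (hM : ∀ (s : Fin (p + 1)) (u : ↥(integralForms Φ (2 * p))), u ∈ M s ↔
      ((s : ℕ).factorial * ∏ i : Fin s, d (Fin.castLE ((Nat.le_of_lt_succ s.isLt).trans hp) i)) • u ∈ N s) :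
    (Λ ⊔ (B.restrict (AddSubgroup.toIntSubmodule ((integralHodgeClassesIn Φ (2 * p) p).addSubgroupOf (integralForms Φ (2 * p))))).orthogonal Λ).toAddSubgroup.index = 1 ∧
      ((LinearMap.range (B.restrict (AddSubgroup.toIntSubmodule ((integralHodgeClassesIn Φ (2 * p) p).addSubgroupOf (integralForms Φ (2 * p)))) γM)).toAddSubgroup.relIndex (LinearMap.range (B (γM : ↥(integralForms Φ (2 * p))))).toAddSubgroup) * ((p.factorial * ∏ i : Fin p, d (Fin.castLE hp i)) * ((p + q).factorial * ∏ i : Fin (p + q), d (Fin.castLE hpq i))) = (j + 2).factorial * ∏ i, d i ∧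
      ((⨆ s, M s).comap (AddSubgroup.inclusion (integralHodgeClassesIn_le_integralForms Φ (2 * p) p)).toIntLinearMap).toAddSubgroup.index = 1 ∧
      ((⨆ s, N s).comap (AddSubgroup.inclusion (integralHodgeClassesIn_le_integralForms Φ (2 * p) p)).toIntLinearMap).toAddSubgroup.index = p.factorial * ∏ i : Fin p, d (Fin.castLE hp i) := by
  have hall := hd.exists_int_smul_minimalClass_eq_of_finrank_hodgeClasses_eq_one hη hp hBp γM hγM
  have hmain := hd.top_splitting_of_forall_exists_smul hη hp hq hpq hkq hγq e hn hB γM hγM Λ hΛ hall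
  have hdef := hd.index_comap_iSup_minimalClassPieces_eq_one_of_forall_exists_smul hη hp hq hpq hkq hγq e hn hB γM hγM Λ hΛ hall N hN M hM
  exact ⟨hmain.1, hmain.2.2.1, hdef.2.2.2.1, hdef.2.2.2.2.trans (hd.prod_content_pow_finrank_primitive_eq_content hη hp hp1 hB1)⟩

/-- **THE HODGE LATTICE WHEN `Sp(Λ_ℝ, E) ⊆ Hg(X)`** (the general member of `A_D`; `2p + q = g`, `p + 1 ≤ g`): `J_p = 1`, `n_p · (p!·d₁⋯d_p)·((g−p)!·d₁⋯d_{g−p}) = g!·d₁⋯d_g`,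
`I'_p = 1`, and **`I_p = [Hdgᵖ(X, ℤ) : ⊕_s θ^{∧s} ∧ Hdg^{p−s}(X, ℤ)_prim] = p!·d₁⋯d_p`** (`= p!` for a principal polarisation).
[cite: Lange2023AbelianVarietiesComplex, §7.3.1 Thm. 7.3.1, Prop. 7.3.2, Prop. 7.3.3 (PDF pp. 336–337); §5.4.1 Thm. 5.4.2 and (5.22)–(5.23) (PDF p. 275); §2.5.3 Thm. 2.5.16, Cor. 2.5.17 (d) (PDF p. 135)]
[cite: BenoistDebarre2023SmoothSubvarietiesJacobians, §1 (p. 3)] [cite: Kitaoka1993, Ch. 5 Prop. 5.3.3 (proof)] -/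
theorem IsPolarizationType.index_comap_iSup_lefschetzPieces_eq_content_of_spGroup_le [FiniteDimensional ℂ E] (hd : IsPolarizationType Φ η d)
    (hη : IsRiemannForm Φ η) (hHg : spGroup Φ η ≤ hodgeGroup Φ) (hp : p ≤ j + 2) (hq : q ≤ j + 2) (hpq : p + q ≤ j + 2) (hkq : 2 * p + q = j + 2) (hp1 : p + 1 ≤ j + 2)
    {γq : E [⋀^Fin (2 * q)]→L[ℝ] ℂ} (hγq : wedgePow (ofRealForm η) q = ((q.factorial * ∏ i : Fin q, d (Fin.castLE hq i) : ℕ) : ℂ) • γq)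
    (e : Fin n ≃ ι) (hn : 2 * p + (2 * q + 2 * p) = n) {B : BilinForm ℤ ↥(integralForms Φ (2 * p))}
    (hB : ∀ x y : ↥(integralForms Φ (2 * p)),
      ((B x y : ℤ) : ℂ) = poincarePairing Φ e hn (x : E [⋀^Fin (2 * p)]→L[ℝ] ℂ) (γq.wedge (y : E [⋀^Fin (2 * p)]→L[ℝ] ℂ)))
    (γM : ↥(AddSubgroup.toIntSubmodule ((integralHodgeClassesIn Φ (2 * p) p).addSubgroupOf (integralForms Φ (2 * p)))))
    (hγM : wedgePow (ofRealForm η) p = ((p.factorial * ∏ i : Fin p, d (Fin.castLE hp i) : ℕ) : ℂ) •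
      (((γM : ↥(AddSubgroup.toIntSubmodule ((integralHodgeClassesIn Φ (2 * p) p).addSubgroupOf (integralForms Φ (2 * p))))) : ↥(integralForms Φ (2 * p))) : E [⋀^Fin (2 * p)]→L[ℝ] ℂ))
    (Λ : Submodule ℤ ↥(AddSubgroup.toIntSubmodule ((integralHodgeClassesIn Φ (2 * p) p).addSubgroupOf (integralForms Φ (2 * p))))) (hΛ : ∀ x, x ∈ Λ ↔ ∃ a : ℤ, a • γM = x)
    (N : Fin (p + 1) → Submodule ℤ ↥(integralForms Φ (2 * p)))
    (hN : ∀ (s : Fin (p + 1)) (u : ↥(integralForms Φ (2 * p))), u ∈ N s ↔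
      ∃ (m i : ℕ) (_ : i + i = m) (h : 2 * (s : ℕ) + m = 2 * p) (y : E [⋀^Fin m]→L[ℝ] ℂ),
        y ∈ integralHodgeClassesIn Φ m i ∧ y ∈ primitiveForms η m ∧ (u : E [⋀^Fin (2 * p)]→L[ℝ] ℂ) = lefschetzPow η (s : ℕ) h y)
    (M : Fin (p + 1) → Submodule ℤ ↥(integralForms Φ (2 * p)))
    (hM : ∀ (s : Fin (p + 1)) (u : ↥(integralForms Φ (2 * p))), u ∈ M s ↔
      ((s : ℕ).factorial * ∏ i : Fin s, d (Fin.castLE ((Nat.le_of_lt_succ s.isLt).trans hp) i)) • u ∈ N s) :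
    (Λ ⊔ (B.restrict (AddSubgroup.toIntSubmodule ((integralHodgeClassesIn Φ (2 * p) p).addSubgroupOf (integralForms Φ (2 * p))))).orthogonal Λ).toAddSubgroup.index = 1 ∧
      ((LinearMap.range (B.restrict (AddSubgroup.toIntSubmodule ((integralHodgeClassesIn Φ (2 * p) p).addSubgroupOf (integralForms Φ (2 * p)))) γM)).toAddSubgroup.relIndex (LinearMap.range (B (γM : ↥(integralForms Φ (2 * p))))).toAddSubgroup) * ((p.factorial * ∏ i : Fin p, d (Fin.castLE hp i)) * ((p + q).factorial * ∏ i : Fin (p + q), d (Fin.castLE hpq i))) = (j + 2).factorial * ∏ i, d i ∧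
      ((⨆ s, M s).comap (AddSubgroup.inclusion (integralHodgeClassesIn_le_integralForms Φ (2 * p) p)).toIntLinearMap).toAddSubgroup.index = 1 ∧
      ((⨆ s, N s).comap (AddSubgroup.inclusion (integralHodgeClassesIn_le_integralForms Φ (2 * p) p)).toIntLinearMap).toAddSubgroup.index = p.factorial * ∏ i : Fin p, d (Fin.castLE hp i) :=
  hd.index_comap_iSup_lefschetzPieces_eq_content_of_finrank_hodgeClasses_eq_one hη hp hq hpq hkq hp1
    (fun _ _ hip ↦ hd.finrank_hodgeClasses_eq_one_of_spGroup_le hη hHg (hip.trans hp)) (hd.finrank_hodgeClasses_eq_one_of_spGroup_le hη hHg hp)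
    hγq e hn hB γM hγM Λ hΛ N hN M hM

end Primitive

/-! ## §5 Conversely: when is the top splitting exact (`J_p = 1`)? -/

section Exact

variable {V : Type*} [AddCommGroup V]

/-- `Λ^⊥ = ker B(γ, ·)` for the line `Λ = ℤγ`. [folklore] -/
private theorem mem_orthogonal_line_iff₁₀₁ (B : BilinForm ℤ V) (γ : V) (Λ : Submodule ℤ V) (hΛ : ∀ x, x ∈ Λ ↔ ∃ a : ℤ, a • γ = x) (x : V) :
    x ∈ B.orthogonal Λ ↔ B γ x = 0 := by
  rw [LinearMap.BilinForm.mem_orthogonal_iff]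
  refine ⟨fun h ↦ h γ ((hΛ γ).2 ⟨1, one_smul _ _⟩), fun h n hn ↦ ?_⟩
  obtain ⟨a, rfl⟩ := (hΛ n).1 hn
  rw [show B (a • γ) x = B.flip x (a • γ) from rfl, map_zsmul, show B.flip x γ = B γ x from rfl, h, smul_zero]

/-- **`x ∈ Λ ⊕ Λ^⊥ ⟺ B(γ, γ) ∣ B(γ, x)`** for the line `Λ = ℤγ` (`x = aγ + (x − aγ)` with `B(γ, x) = a·B(γ, γ)`).
[cite: Kitaoka1993, Ch. 5 Prop. 5.3.3 (proof)] [cite: Huybrechts2016K3, Ch. 14 §0.2] -/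
theorem mem_line_sup_orthogonal_iff_dvd (B : BilinForm ℤ V) (γ : V) (Λ : Submodule ℤ V) (hΛ : ∀ x, x ∈ Λ ↔ ∃ a : ℤ, a • γ = x)
    (x : V) : x ∈ Λ ⊔ B.orthogonal Λ ↔ B γ γ ∣ B γ x := by
  have hO := mem_orthogonal_line_iff₁₀₁ B γ Λ hΛ
  constructor
  · intro hx
    obtain ⟨y, hy, z, hz, rfl⟩ := Submodule.mem_sup.1 hx
    obtain ⟨a, rfl⟩ := (hΛ y).1 hy
    exact ⟨a, by rw [map_add, (hO z).1 hz, add_zero, map_zsmul, zsmul_eq_mul, Int.cast_id, mul_comm]⟩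
  · rintro ⟨a, ha⟩
    refine Submodule.mem_sup.2 ⟨a • γ, (hΛ _).2 ⟨a, rfl⟩, x - a • γ, (hO _).2 ?_, by abel⟩
    rw [map_sub, map_zsmul, ha, zsmul_eq_mul, Int.cast_id, mul_comm, sub_self]

/-- **`[V : Λ ⊕ Λ^⊥] = 1 ⟺ V = Λ ⊕ Λ^⊥ ⟺ B(γ, γ) ∣ B(γ, x)` for all `x` `⟺ [ℤ : B(γ, V)] = |B(γ, γ)|`** (the value group of `γ` is `B(γ, γ)·ℤ`): a line `ℤγ` with
`B(γ, γ) ≠ 0` is an orthogonal direct summand iff its self-intersection divides all its values (Kitaoka's `V/(Λ ⊥ Λ^⊥) ↪ Λ♯/Λ` is zero).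
[cite: Kitaoka1993, Ch. 5 Prop. 5.3.3 (proof)] [cite: Huybrechts2016K3, Ch. 14 §0.1–§0.2] -/
theorem index_line_sup_orthogonal_eq_one_iff (B : BilinForm ℤ V) (γ : V) (Λ : Submodule ℤ V) (hΛ : ∀ x, x ∈ Λ ↔ ∃ a : ℤ, a • γ = x)
    (h0 : B γ γ ≠ 0) :
    ((Λ ⊔ B.orthogonal Λ).toAddSubgroup.index = 1 ↔ Λ ⊔ B.orthogonal Λ = ⊤) ∧
      ((Λ ⊔ B.orthogonal Λ).toAddSubgroup.index = 1 ↔ ∀ x, B γ γ ∣ B γ x) ∧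
      ((Λ ⊔ B.orthogonal Λ).toAddSubgroup.index = 1 ↔ (LinearMap.range (B γ)).toAddSubgroup.index = (B γ γ).natAbs) := by
  have h1 : (Λ ⊔ B.orthogonal Λ).toAddSubgroup.index = 1 ↔ Λ ⊔ B.orthogonal Λ = ⊤ := by
    rw [AddSubgroup.index_eq_one]
    exact ⟨fun h ↦ Submodule.toAddSubgroup_injective (h.trans Submodule.top_toAddSubgroup.symm), fun h ↦ h ▸ Submodule.top_toAddSubgroup⟩
  have hprod := index_line_sup_orthogonal_mul_index_range_eq_natAbs B γ Λ hΛ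
  have hpos := (index_line_sup_orthogonal_pos B γ Λ hΛ h0).2
  refine ⟨h1, h1.trans ⟨fun h x ↦ (mem_line_sup_orthogonal_iff_dvd B γ Λ hΛ x).1 (h ▸ Submodule.mem_top),
    fun h ↦ eq_top_iff.2 fun x _ ↦ (mem_line_sup_orthogonal_iff_dvd B γ Λ hΛ x).2 (h x)⟩, ⟨fun h ↦ ?_, fun h ↦ ?_⟩⟩
  · rw [h, one_mul] at hprod
    exact hprod
  · rw [h] at hprod
    exact Nat.eq_of_mul_eq_mul_right (Nat.pos_of_ne_zero (Int.natAbs_ne_zero.2 h0)) (hprod.trans (one_mul _).symm)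

/-- `J · X = C` with `0 < X` gives `J = 1 ↔ X = C`. [folklore] -/
private theorem eq_one_iff_of_mul_eq₁₀₁ {J X C : ℕ} (h : J * X = C) (hX : 0 < X) : J = 1 ↔ X = C := by
  constructor
  · intro hJ
    rw [hJ, one_mul] at h
    exact h
  · intro hXC
    rw [hXC] at h
    exact Nat.eq_of_mul_eq_mul_right (hXC ▸ hX) (h.trans (one_mul _).symm)

variable {ι : Type*} [Fintype ι] [DecidableEq ι] {E : Type*} [NormedAddCommGroup E] [NormedSpace ℂ E]
  {Φ : (ι → ℝ) ≃L[ℝ] E} {j n p q : ℕ} {η : E [⋀^Fin 2]→L[ℝ] ℝ} {d : Fin (j + 2) → ℕ}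

/-- **WHEN IS THE TOP SPLITTING EXACT? `J_p = [Hdgᵖ(X, ℤ) : ℤγ_p ⊕ γ_p^⊥] = 1 ⟺ Hdgᵖ(X, ℤ) = ℤγ_p ⊕ γ_p^⊥ ⟺ B(γ_p, γ_p) ∣ B(γ_p, x)` for every `x ∈ Hdgᵖ(X, ℤ)`
`⟺ m_p = [ℤ : B(γ_p, Hdgᵖ(X, ℤ))] = |B(γ_p, γ_p)| ⟺ n_p · (p!·d₁⋯d_p)·((g−p)!·d₁⋯d_{g−p}) = g!·d₁⋯d_g`** (`2p + q = g`; the last by g48-#6's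
`J_p · n_p · (p!·d₁⋯d_p)·((g−p)!·d₁⋯d_{g−p}) = g!·d₁⋯d_g`): the minimal class is an orthogonal direct summand of the Hodge lattice iff its self-intersection
`B(γ_p, γ_p) = ±g!·d₁⋯d_g/((p!·d₁⋯d_p)²(q!·d₁⋯d_q))` divides all its values on Hodge classes, iff the `θ`-degree index `n_p` is the whole lattice binomial; §2 (`Hdgᵖ(X, ℤ) = ℤγ_p`)
is the case `γ_p^⊥ = 0`. [cite: Lange2023AbelianVarietiesComplex, §5.4.1 Thm. 5.4.2 and (5.22)–(5.23) (PDF p. 275); §2.5.3 Cor. 2.5.17 (d) (PDF p. 135)] [cite: Kitaoka1993, Ch. 5 Prop. 5.3.3 (proof)]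
[cite: Huybrechts2016K3, Ch. 14 §0.1–§0.2] -/
theorem IsPolarizationType.index_top_splitting_eq_one_iff (hd : IsPolarizationType Φ η d) (hη : IsRiemannForm Φ η)
    (hp : p ≤ j + 2) (hq : q ≤ j + 2) (hpq : p + q ≤ j + 2) (hkq : 2 * p + q = j + 2)
    {γq : E [⋀^Fin (2 * q)]→L[ℝ] ℂ} (hγq : wedgePow (ofRealForm η) q = ((q.factorial * ∏ i : Fin q, d (Fin.castLE hq i) : ℕ) : ℂ) • γq)
    (e : Fin n ≃ ι) (hn : 2 * p + (2 * q + 2 * p) = n) {B : BilinForm ℤ ↥(integralForms Φ (2 * p))}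
    (hB : ∀ x y : ↥(integralForms Φ (2 * p)),
      ((B x y : ℤ) : ℂ) = poincarePairing Φ e hn (x : E [⋀^Fin (2 * p)]→L[ℝ] ℂ) (γq.wedge (y : E [⋀^Fin (2 * p)]→L[ℝ] ℂ)))
    (γM : ↥(AddSubgroup.toIntSubmodule ((integralHodgeClassesIn Φ (2 * p) p).addSubgroupOf (integralForms Φ (2 * p)))))
    (hγM : wedgePow (ofRealForm η) p = ((p.factorial * ∏ i : Fin p, d (Fin.castLE hp i) : ℕ) : ℂ) •
      (((γM : ↥(AddSubgroup.toIntSubmodule ((integralHodgeClassesIn Φ (2 * p) p).addSubgroupOf (integralForms Φ (2 * p))))) : ↥(integralForms Φ (2 * p))) : E [⋀^Fin (2 * p)]→L[ℝ] ℂ))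
    (Λ : Submodule ℤ ↥(AddSubgroup.toIntSubmodule ((integralHodgeClassesIn Φ (2 * p) p).addSubgroupOf (integralForms Φ (2 * p))))) (hΛ : ∀ x, x ∈ Λ ↔ ∃ a : ℤ, a • γM = x) :
    ((Λ ⊔ (B.restrict (AddSubgroup.toIntSubmodule ((integralHodgeClassesIn Φ (2 * p) p).addSubgroupOf (integralForms Φ (2 * p))))).orthogonal Λ).toAddSubgroup.index = 1 ↔ Λ ⊔ (B.restrict (AddSubgroup.toIntSubmodule ((integralHodgeClassesIn Φ (2 * p) p).addSubgroupOf (integralForms Φ (2 * p))))).orthogonal Λ = ⊤) ∧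
      ((Λ ⊔ (B.restrict (AddSubgroup.toIntSubmodule ((integralHodgeClassesIn Φ (2 * p) p).addSubgroupOf (integralForms Φ (2 * p))))).orthogonal Λ).toAddSubgroup.index = 1 ↔ ∀ x : ↥(AddSubgroup.toIntSubmodule ((integralHodgeClassesIn Φ (2 * p) p).addSubgroupOf (integralForms Φ (2 * p)))), B (γM : ↥(integralForms Φ (2 * p))) (γM : ↥(integralForms Φ (2 * p))) ∣ B (γM : ↥(integralForms Φ (2 * p))) (x : ↥(integralForms Φ (2 * p)))) ∧
      ((Λ ⊔ (B.restrict (AddSubgroup.toIntSubmodule ((integralHodgeClassesIn Φ (2 * p) p).addSubgroupOf (integralForms Φ (2 * p))))).orthogonal Λ).toAddSubgroup.index = 1 ↔ (LinearMap.range (B.restrict (AddSubgroup.toIntSubmodule ((integralHodgeClassesIn Φ (2 * p) p).addSubgroupOf (integralForms Φ (2 * p)))) γM)).toAddSubgroup.index = (B (γM : ↥(integralForms Φ (2 * p))) (γM : ↥(integralForms Φ (2 * p)))).natAbs) ∧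
      ((Λ ⊔ (B.restrict (AddSubgroup.toIntSubmodule ((integralHodgeClassesIn Φ (2 * p) p).addSubgroupOf (integralForms Φ (2 * p))))).orthogonal Λ).toAddSubgroup.index = 1 ↔ ((LinearMap.range (B.restrict (AddSubgroup.toIntSubmodule ((integralHodgeClassesIn Φ (2 * p) p).addSubgroupOf (integralForms Φ (2 * p)))) γM)).toAddSubgroup.relIndex (LinearMap.range (B (γM : ↥(integralForms Φ (2 * p))))).toAddSubgroup) * ((p.factorial * ∏ i : Fin p, d (Fin.castLE hp i)) * ((p + q).factorial * ∏ i : Fin (p + q), d (Fin.castLE hpq i))) = (j + 2).factorial * ∏ i, d i) := by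
  have hg : p + (q + p) = j + 2 := by omega
  have h0 := (hd.natAbs_apply_minimalClass_self_mul_content_eq hη hp hq hg hγM hγq e hn hB (γM : ↥(integralForms Φ (2 * p))) rfl).2
  have hgen := index_line_sup_orthogonal_eq_one_iff (B.restrict (AddSubgroup.toIntSubmodule ((integralHodgeClassesIn Φ (2 * p) p).addSubgroupOf (integralForms Φ (2 * p))))) γM Λ hΛ h0
  have h6 := hd.index_top_splitting_mul_relIndex_range_mul_content_eq hη hp hq hpq hkq hγq e hn hB γM hγM Λ hΛ
  have hX : 0 < ((LinearMap.range (B.restrict (AddSubgroup.toIntSubmodule ((integralHodgeClassesIn Φ (2 * p) p).addSubgroupOf (integralForms Φ (2 * p)))) γM)).toAddSubgroup.relIndex (LinearMap.range (B (γM : ↥(integralForms Φ (2 * p))))).toAddSubgroup) * ((p.factorial * ∏ i : Fin p, d (Fin.castLE hp i)) * ((p + q).factorial * ∏ i : Fin (p + q), d (Fin.castLE hpq i))) :=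
    Nat.mul_pos h6.2.1 (Nat.mul_pos (Nat.mul_pos (Nat.factorial_pos _) (Finset.prod_pos fun i _ ↦ hd.pos hη _))
      (Nat.mul_pos (Nat.factorial_pos _) (Finset.prod_pos fun i _ ↦ hd.pos hη _)))
  exact ⟨hgen.1, hgen.2.1, hgen.2.2, eq_one_iff_of_mul_eq₁₀₁ (by simpa only [mul_assoc] using h6.1) hX⟩

/-- **Principal polarisation: `J_p = 1 ⟺ n_p = C(g, p)`.** [cite: Lange2023AbelianVarietiesComplex, §5.4.1 (5.22)–(5.23) (PDF p. 275); §2.5.3 Cor. 2.5.17 (d) (PDF p. 135)] -/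
theorem IsPolarizationType.index_top_splitting_eq_one_iff_relIndex_range_eq_choose (hd : IsPolarizationType Φ η d) (hη : IsRiemannForm Φ η)
    (h1 : ∀ i, d i = 1) (hp : p ≤ j + 2) (hq : q ≤ j + 2) (hpq : p + q ≤ j + 2) (hkq : 2 * p + q = j + 2)
    {γq : E [⋀^Fin (2 * q)]→L[ℝ] ℂ} (hγq : wedgePow (ofRealForm η) q = ((q.factorial * ∏ i : Fin q, d (Fin.castLE hq i) : ℕ) : ℂ) • γq)
    (e : Fin n ≃ ι) (hn : 2 * p + (2 * q + 2 * p) = n) {B : BilinForm ℤ ↥(integralForms Φ (2 * p))}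
    (hB : ∀ x y : ↥(integralForms Φ (2 * p)),
      ((B x y : ℤ) : ℂ) = poincarePairing Φ e hn (x : E [⋀^Fin (2 * p)]→L[ℝ] ℂ) (γq.wedge (y : E [⋀^Fin (2 * p)]→L[ℝ] ℂ)))
    (γM : ↥(AddSubgroup.toIntSubmodule ((integralHodgeClassesIn Φ (2 * p) p).addSubgroupOf (integralForms Φ (2 * p)))))
    (hγM : wedgePow (ofRealForm η) p = ((p.factorial * ∏ i : Fin p, d (Fin.castLE hp i) : ℕ) : ℂ) •
      (((γM : ↥(AddSubgroup.toIntSubmodule ((integralHodgeClassesIn Φ (2 * p) p).addSubgroupOf (integralForms Φ (2 * p))))) : ↥(integralForms Φ (2 * p))) : E [⋀^Fin (2 * p)]→L[ℝ] ℂ))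
    (Λ : Submodule ℤ ↥(AddSubgroup.toIntSubmodule ((integralHodgeClassesIn Φ (2 * p) p).addSubgroupOf (integralForms Φ (2 * p))))) (hΛ : ∀ x, x ∈ Λ ↔ ∃ a : ℤ, a • γM = x) :
    (Λ ⊔ (B.restrict (AddSubgroup.toIntSubmodule ((integralHodgeClassesIn Φ (2 * p) p).addSubgroupOf (integralForms Φ (2 * p))))).orthogonal Λ).toAddSubgroup.index = 1 ↔ (LinearMap.range (B.restrict (AddSubgroup.toIntSubmodule ((integralHodgeClassesIn Φ (2 * p) p).addSubgroupOf (integralForms Φ (2 * p)))) γM)).toAddSubgroup.relIndex (LinearMap.range (B (γM : ↥(integralForms Φ (2 * p))))).toAddSubgroup = (j + 2).choose p :=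
  eq_one_iff_of_mul_eq₁₀₁ (hd.index_top_splitting_mul_relIndex_range_eq_choose hη h1 hp hq hpq hkq hγq e hn hB γM hγM Λ hΛ)
    (hd.index_top_splitting_mul_relIndex_range_mul_content_eq hη hp hq hpq hkq hγq e hn hB γM hγM Λ hΛ).2.1

end Exact

/-! ## §6 `γ_p^⊥` is the lattice of Hodge classes of `θ`-degree zero -/

section DegreeZero

variable {ι : Type*} [Fintype ι] [DecidableEq ι] {E : Type*} [NormedAddCommGroup E] [NormedSpace ℂ E]
  {Φ : (ι → ℝ) ≃L[ℝ] E} {j n p q : ℕ} {η : E [⋀^Fin 2]→L[ℝ] ℝ} {d : Fin (j + 2) → ℕ}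

/-- **`γ_p^⊥ = {y ∈ Hdgᵖ(X, ℤ) : deg_θ(y) = ⟨θ^{∧(g−p)}, y⟩_e = 0}`** (`2p + q = g`, `B = ⟨·, γ_q ∧ ·⟩_e`, `Λ = ℤγ_p`): the orthogonal complement of the minimal class in the
Hodge lattice is the lattice of integral Hodge classes of `θ`-DEGREE ZERO, equivalently `⟨γ_{g−p}, y⟩_e = 0`, since
`(p!·d₁⋯d_p)(q!·d₁⋯d_q)·B(γ_p, y) = ((g−p)!·d₁⋯d_{g−p})·⟨γ_{g−p}, y⟩_e = ⟨θ^{∧p}, θ^{∧q} ∧ y⟩_e = ⟨θ^{∧(g−p)}, y⟩_e` (g48-#6 §1). So the top splitting reads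
`Hdgᵖ(X, ℤ) ⊇ ℤγ_p ⊕ Hdgᵖ(X, ℤ)_{deg_θ = 0}` with index `J_p`; for `p = 1` this is `NS(X) ⊇ ℤγ₁ ⊕ NS(X)_prim` (`deg_θ = 0 ⟺` primitive in degree `2`, g42-#8), for `p ≥ 2` the
`θ`-degree-zero classes contain the primitive ones strictly in general (g49-#2's defect `D_p`).
[cite: Lange2023AbelianVarietiesComplex, §5.4.1 Thm. 5.4.2 and (5.22)–(5.23) (PDF p. 275); §2.5.3 Thm. 2.5.16 (PDF p. 135); §6.2.4 (PDF p. 310)] [cite: Kitaoka1993, Ch. 5 Prop. 5.3.3] -/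
theorem IsPolarizationType.mem_orthogonal_minimalClass_iff_poincarePairing_wedgePow_eq_zero (hd : IsPolarizationType Φ η d) (hη : IsRiemannForm Φ η)
    (hp : p ≤ j + 2) (hq : q ≤ j + 2) (hpq : p + q ≤ j + 2)
    {γq : E [⋀^Fin (2 * q)]→L[ℝ] ℂ} (hγq : wedgePow (ofRealForm η) q = ((q.factorial * ∏ i : Fin q, d (Fin.castLE hq i) : ℕ) : ℂ) • γq)
    {γpq : E [⋀^Fin (2 * (p + q))]→L[ℝ] ℂ}
    (hγpq : wedgePow (ofRealForm η) (p + q) = (((p + q).factorial * ∏ i : Fin (p + q), d (Fin.castLE hpq i) : ℕ) : ℂ) • γpq)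
    (e : Fin n ≃ ι) (hn : 2 * p + (2 * q + 2 * p) = n) (hn' : 2 * (p + q) + 2 * p = n) {B : BilinForm ℤ ↥(integralForms Φ (2 * p))}
    (hB : ∀ x y : ↥(integralForms Φ (2 * p)),
      ((B x y : ℤ) : ℂ) = poincarePairing Φ e hn (x : E [⋀^Fin (2 * p)]→L[ℝ] ℂ) (γq.wedge (y : E [⋀^Fin (2 * p)]→L[ℝ] ℂ)))
    (γM : ↥(AddSubgroup.toIntSubmodule ((integralHodgeClassesIn Φ (2 * p) p).addSubgroupOf (integralForms Φ (2 * p)))))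
    (hγM : wedgePow (ofRealForm η) p = ((p.factorial * ∏ i : Fin p, d (Fin.castLE hp i) : ℕ) : ℂ) •
      (((γM : ↥(AddSubgroup.toIntSubmodule ((integralHodgeClassesIn Φ (2 * p) p).addSubgroupOf (integralForms Φ (2 * p))))) : ↥(integralForms Φ (2 * p))) : E [⋀^Fin (2 * p)]→L[ℝ] ℂ))
    (Λ : Submodule ℤ ↥(AddSubgroup.toIntSubmodule ((integralHodgeClassesIn Φ (2 * p) p).addSubgroupOf (integralForms Φ (2 * p))))) (hΛ : ∀ x, x ∈ Λ ↔ ∃ a : ℤ, a • γM = x) (y : ↥(AddSubgroup.toIntSubmodule ((integralHodgeClassesIn Φ (2 * p) p).addSubgroupOf (integralForms Φ (2 * p))))) :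
    (y ∈ (B.restrict (AddSubgroup.toIntSubmodule ((integralHodgeClassesIn Φ (2 * p) p).addSubgroupOf (integralForms Φ (2 * p))))).orthogonal Λ ↔ poincarePairing Φ e hn' (wedgePow (ofRealForm η) (p + q)) (((y : ↥(AddSubgroup.toIntSubmodule ((integralHodgeClassesIn Φ (2 * p) p).addSubgroupOf (integralForms Φ (2 * p))))) : ↥(integralForms Φ (2 * p))) : E [⋀^Fin (2 * p)]→L[ℝ] ℂ) = 0) ∧
      (y ∈ (B.restrict (AddSubgroup.toIntSubmodule ((integralHodgeClassesIn Φ (2 * p) p).addSubgroupOf (integralForms Φ (2 * p))))).orthogonal Λ ↔ poincarePairing Φ e hn' γpq (((y : ↥(AddSubgroup.toIntSubmodule ((integralHodgeClassesIn Φ (2 * p) p).addSubgroupOf (integralForms Φ (2 * p))))) : ↥(integralForms Φ (2 * p))) : E [⋀^Fin (2 * p)]→L[ℝ] ℂ) = 0) ∧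
      (y ∈ (B.restrict (AddSubgroup.toIntSubmodule ((integralHodgeClassesIn Φ (2 * p) p).addSubgroupOf (integralForms Φ (2 * p))))).orthogonal Λ ↔ B (γM : ↥(integralForms Φ (2 * p))) (y : ↥(integralForms Φ (2 * p))) = 0) := by
  have hO := mem_orthogonal_line_iff₁₀₁ (B.restrict (AddSubgroup.toIntSubmodule ((integralHodgeClassesIn Φ (2 * p) p).addSubgroupOf (integralForms Φ (2 * p))))) γM Λ hΛ y
  have hval : (B.restrict (AddSubgroup.toIntSubmodule ((integralHodgeClassesIn Φ (2 * p) p).addSubgroupOf (integralForms Φ (2 * p))))) γM y = B (γM : ↥(integralForms Φ (2 * p))) (y : ↥(integralForms Φ (2 * p))) :=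
    (LinearMap.congr_fun (LinearMap.BilinForm.restrict_apply B _ γM) y).trans (LinearMap.domRestrict_apply _ _ _)
  have h3 : y ∈ (B.restrict (AddSubgroup.toIntSubmodule ((integralHodgeClassesIn Φ (2 * p) p).addSubgroupOf (integralForms Φ (2 * p))))).orthogonal Λ ↔ B (γM : ↥(integralForms Φ (2 * p))) (y : ↥(integralForms Φ (2 * p))) = 0 := by
    rw [hO, hval]
  have hkey := content_mul_apply_minimalClass_eq hp hq hpq hγq hγpq e hn hn' hB (γM : ↥(integralForms Φ (2 * p))) hγM (y : ↥(integralForms Φ (2 * p)))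
  have hC0 : ((((p.factorial * ∏ i : Fin p, d (Fin.castLE hp i)) * (q.factorial * ∏ i : Fin q, d (Fin.castLE hq i)) : ℕ)) : ℂ) ≠ 0 := by
    exact_mod_cast (Nat.mul_pos (Nat.mul_pos (Nat.factorial_pos p) (Finset.prod_pos fun i _ ↦ hd.pos hη _))
      (Nat.mul_pos (Nat.factorial_pos q) (Finset.prod_pos fun i _ ↦ hd.pos hη _))).ne'
  have hC'0 : ((((p + q).factorial * ∏ i : Fin (p + q), d (Fin.castLE hpq i)) : ℕ) : ℂ) ≠ 0 := by
    exact_mod_cast (Nat.mul_pos (Nat.factorial_pos _) (Finset.prod_pos fun i _ ↦ hd.pos hη _)).ne'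
  have h2 : B (γM : ↥(integralForms Φ (2 * p))) (y : ↥(integralForms Φ (2 * p))) = 0 ↔ poincarePairing Φ e hn' γpq (((y : ↥(AddSubgroup.toIntSubmodule ((integralHodgeClassesIn Φ (2 * p) p).addSubgroupOf (integralForms Φ (2 * p))))) : ↥(integralForms Φ (2 * p))) : E [⋀^Fin (2 * p)]→L[ℝ] ℂ) = 0 := by
    constructor
    · intro h0
      rw [h0, Int.cast_zero, mul_zero] at hkey
      exact (mul_eq_zero.1 hkey.symm).resolve_left hC'0
    · intro h0
      rw [h0, mul_zero] at hkey
      exact_mod_cast (mul_eq_zero.1 hkey).resolve_left hC0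
  have hlin : poincarePairing Φ e hn' (wedgePow (ofRealForm η) (p + q)) (((y : ↥(AddSubgroup.toIntSubmodule ((integralHodgeClassesIn Φ (2 * p) p).addSubgroupOf (integralForms Φ (2 * p))))) : ↥(integralForms Φ (2 * p))) : E [⋀^Fin (2 * p)]→L[ℝ] ℂ) =
      ((((p + q).factorial * ∏ i : Fin (p + q), d (Fin.castLE hpq i)) : ℕ) : ℂ) * poincarePairing Φ e hn' γpq (((y : ↥(AddSubgroup.toIntSubmodule ((integralHodgeClassesIn Φ (2 * p) p).addSubgroupOf (integralForms Φ (2 * p))))) : ↥(integralForms Φ (2 * p))) : E [⋀^Fin (2 * p)]→L[ℝ] ℂ) := by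
    rw [hγpq, LinearMap.map_smul, LinearMap.smul_apply, smul_eq_mul]
  have h1 : poincarePairing Φ e hn' (wedgePow (ofRealForm η) (p + q)) (((y : ↥(AddSubgroup.toIntSubmodule ((integralHodgeClassesIn Φ (2 * p) p).addSubgroupOf (integralForms Φ (2 * p))))) : ↥(integralForms Φ (2 * p))) : E [⋀^Fin (2 * p)]→L[ℝ] ℂ) = 0 ↔ poincarePairing Φ e hn' γpq (((y : ↥(AddSubgroup.toIntSubmodule ((integralHodgeClassesIn Φ (2 * p) p).addSubgroupOf (integralForms Φ (2 * p))))) : ↥(integralForms Φ (2 * p))) : E [⋀^Fin (2 * p)]→L[ℝ] ℂ) = 0 := by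
    rw [hlin, mul_eq_zero, or_iff_right hC'0]
  exact ⟨h3.trans (h2.trans h1.symm), h3.trans h2, h3⟩

end DegreeZero

end Literature.Geometry.Kaehler.ComplexTorus

end
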